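import Literature.NumberTheory.GelbartRogawski1991.PiSCompletionIsThetaTypeTestSigned   -- ★ p848317 the (D-b)ᵀˢ DEF (commit a92c962f4cb1) — head token BY NAME
import Literature.NumberTheory.GelbartRogawski1991.PiSCompletionIsThetaTypeTestSignedW1 -- ★ p848883 (D-b)ᵀˢ-W1 DEF (LH10-plan ROAD W (b))
import Literature.NumberTheory.Rogawski1990.GlobalAPacketMembership                 -- ★ D6 `MemXiFamily`, `LocalConstituentsIn` currency (`IrrClass.IsConstituentOf`, `localPiEquiv`, `inclPlace`)
import Literature.NumberTheory.Rogawski1990.LocalTransferExistence                 -- ★ (H₇) `IsLocalDeltaTransferExists`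
import Literature.NumberTheory.Rogawski1990.FinExplicitTransferFactorConjLeft      -- ★ print's `Δ‴` = `finExplicitCollection` + `finExplicitDelta_conj_left_all` (r359 ⑨ pin)
import Literature.NumberTheory.Rogawski1990.FinExplicitTransferFactorConjRight     -- ★ `finExplicitDelta_conj_right_all`
import Literature.NumberTheory.Automorphic.OrbitalMeasureCanonical                 -- ★ `OrbitalMeasureFamily.IsCanonical` (canonical orbital measures, r359 ⑨ pin)
import Summits.HodgeConjecture.HodgeConjecture.Theorems.F0P3cStCharTSNe            -- ★ GLUE «Ne» `ne_comap_πn_of_isSupercuspidal` (LH6-p02)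
import Summits.HodgeConjecture.HodgeConjecture.Theorems.F0P3cDbTEnvelopePeelPinned -- ★ (O2) peel `stubXiPacketRigidAtRecord_of_core_pinned` (LH10-p01 p848467), ED. 4
import Summits.HodgeConjecture.HodgeConjecture.Theorems.F0P3cDbTThetaOccurrenceLiuLocus -- ★ (O1-W1) closer `stubThetaLiftMember_liuLocus` (LH10-p02 p848642, commit da5c4edfd102)
import Summits.HodgeConjecture.HodgeConjecture.Theorems.F0P3cDbTThetaRoadW1       -- ★ p850793 ROAD Θ letter: organ (O2θ-W1) `StubThetaTypeScCompletesW1` + HEAD-Θ `dbTSAtRecordW1_of_thetaRoad` (LH10-plan (g3) ∕ LH10-p01 (g4), commit abb1acbbfba9)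
import HarnessLib
/-!
# F0 · P3c · line LH10 «(D-b)ᵀ» — PAYDOWN SKELETON (ED. 9 «O1-RETIRE» = ED. 8 «β-doc + Θ-hook» with the unconsumed O1 term retired, NOT paid) of books row #76 (III-22) TEST edition, SIGNED at the frame multiplier:
# head `Db_T_of_organs : ‹O1› → ‹O2› → ∀ record-currency data, (D-b)ᵀˢ ★ `GelbartRogawski1991.piSCompletion_isThetaTypeAtCMTestSigned …`` BY NAME

Cell hodgecm-mathlib (D-0151), FLOOR 0, crux item H413 = stmt-HodgeConjecture-24833, route of record `HCCMUnconditional` (no route verbs; books count-neutral).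
Seat LH10-plan (g0) (director SEATPLAN-GO500 §1B ∕ §5 T2 addendum; desk F0P3-plan (g13) ruling 2026-09-02T01:57:23Z «LH10 = (D-b)ᵀ [GR91 §5.1 Lem. 5.1.2 non-split]»;
desk STANDING CONDITIONS 02:11:19Z; F0P2-ref1 (g10) r352 box rules (i)–(iv), r353 OBJECTION ⑧ «D7αᵀ-K2 CURRENCY GAP» + (E); LEAD F0P3a-plan RULING «K» (T9-5)).
Tree name on the desk's WORD: `Cruxes/H413/Lines/F0_P3c_DbTPaydown.lean`.  HONEST LABEL: HC_CM is proved only modulo the 7 printed citations (2 remaining: hLiu418 =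
stmt-HodgeConjecture-24832, h413 = stmt-HodgeConjecture-24833) until rung 0 closes; this skeleton discharges NOTHING by itself — it re-expresses the print letter (D-b)ᵀˢ
as two PRINT organs (`stub_*`, sorried here, payable as ★ `Theorems/` files `--supports stmt-HodgeConjecture-24833 --as helper`) + ★ glue, with the composition PROVED.

## TARGET CONSUMER (r352 ASK «name WHICH consumer line»)
ROAD S (r353 (C)): the (H₈ᵀ) conjunct of ★ `Theorems/F0P2oD7alphaMemDockOfRowsT.lean` :144–:147 (`stubD7αMemDockPerMeasureT_of_rows … hrecT`), re-denominated SIGNED by P2's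
adapter B2 «SIGNED ROWS» `stubD7αMemDockPerMeasureT_of_rowsSigned` (F0P2-p01 (g16), r353 DEAL B2) at the closer's record tuple
`(C.𝔨.Δ, C.𝔨.mH, C.mG₀, C.W.νG, C.W.νH, C.hQ : CMCharIdentityPackageTestSigned …, transfer existence from C.htE)` of `Lines/F0_U3LettersRung1KitD.lean` `Rung0Choice`;
discharge road of PKΠ v1.15 `F0_P2PKPiRung4.stub_D7αMemDockμT`.  The head below binds the data INSIDE joint hypotheses exactly as `hrecT` binds `(Haar, hQT, H₇)` — never
free-standing (r235 ∕ r352 (ii) ∕ r353 (E)) — AND AT PRINT'S DATA (F0P2-ref1 r359 OBJECTION ⑨, ED. 3): Borel σ-algebras, Haar + right-invariant `ν_G, ν_H`, the pin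
`hΔ : Δ = finExplicitCollection L H μω (finExplicitDelta_conj_left_all L H μω) (finExplicitDelta_conj_right_all L H μω)` (= print's `Δ‴`, ★ `FinExplicitTransferFactor`) and
`hcan : ∀ v, (mH v).IsCanonical (IsLocalGRegular L v) (νH v) ∧ (mG v).IsCanonical (IsRegularElt ·) (νG v)` (★ `OrbitalMeasureCanonical`) — the closer's own currency names
(`Lines/F0_U3LettersRung1KitRung0.lean` :275–:290).  AT DAY X they are discharged from the rung-0 RECORD `C := rung0Choice …` of
`Lines/F0_U3LettersRung1KitD.lean` ONCE `structure Rung0Choice` carries them as FIELDS — closer edition «Δ‴-PINS EXPOSED» (desk D69, LEAD T12-35 road (K-b)∕(K-c),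
chair r374; found by LHref-S (g2) «DAY-X DRESS REHEARSAL» 2026-09-02T06:51:21Z: as of closer ED. 40 the equation `C.𝔨.Δ = Δ‴` (G1), the canonicity of `C.mG₀` (G2b)
and local Δ-transfer existence at `(C.𝔨.Δ, C.𝔨.mH, C.mG₀)` (G3) are built inside `Kit.rung0_of_letters` but not recorded by `Rung0Choice`): the Day-X term then reads
`Db_T_paidW1 … C.𝔨.Δ C.𝔨.mH C.mG₀ C.W.νG C.W.νH μω hμu hμω μ C.hΔ (fun v => ⟨(IsPinned.canonical C.hpin v).1, C.hcan₀ v⟩) C.hQ C.hex₀ …`.  The pins STAY in this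
leaf's organ and heads (LH10-plan (g2) answer to T12-35 (q), 06:58:42Z): the organ's conclusion `CharIdentityAtTest … (Δ v) (mH v) (mG v)` is relative to the
`Δ v`-transfer, so `hΔ`∕`hcan` are load-bearing for its truth AS PRINTED (r359 ⑨), not droppable binders.

## WHY SIGNED (r353 (A), reached independently by this seat)
At the tree's factor of record `Δ‴_v` print's (13.1.4) on test functions reads `χ_ξ(f^H) = ε_v(a)·(tr πⁿ + tr πˢ)`, `ε_v(a) = ω_{L_w∕L⁺_v}(a)` (RULING «K»; ★
`CharIdentityOnTestFunctionsSigned`).  The UNSIGNED (D-b)ᵀ at `Δ‴` with `ε_v(a) = −1` would need `tr πθ = −2·tr πⁿ∘e − tr πˢ` on `C_c^∞` — refuted by ★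
`IrrClass.linearIndependent_smoothTrace` under (H₇) + Haar `ν_G`.  Hence the head is the SIGNED twin (D-b)ᵀˢ (DEF `PiSCompletionIsThetaTypeTestSigned.lean`, LH10-plan draft
0da05591322c8e46: ★ p840297's text with ONE token changed — member traces `× ε_v(a)`).

## EDITIONS
ED. 1∕2 (v1 84da6c5c4654eed7, v2 4611aa9b45da2330): two organs, record currency.  ED. 3 (d3cbdbee300025aa, WRITTEN commit 208feb1480c5): print's data pins (r359 ⑨).
ED. 4 (this): (O2) is no longer sorried — it is the ★ peel `F0P3cDbTEnvelopePeelPinned.stubXiPacketRigidAtRecord_of_core_pinned` (LH10-p01 p848467) applied to the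
smaller PRINT core (O2♭) `stub_xiPacketRigidCore` (13.3.6 (c): (α) no `π² ∘ e` constituent, (β) supercuspidal constituents complete `πⁿ ∘ e` SIGNED); (O1)'s statement
bytes are unchanged, its docstring now carries ROAD B as the print road of record (LHref-S 02:55:37Z; LH10-p02 «AUTOMORPHY GAP»: road A pays (O1) on the automorphic
locus only).  Sorries = {`stub_thetaLiftMember` (O1), `stub_xiPacketRigidCore` (O2♭)}; head and `Db_T_paid` unchanged.
ED. 5-W (this): §4 ROAD W ADDED (additive; §1–§3 byte-unchanged): (O1-W1) `StubThetaLiftMemberW1` = (O1) on the Liu locus (frame + `HasWeight L μ 1` +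
`IsAutomorphicOneChar … χf` + `μA`), CLOSED BY NAME from ★ LH10-p02 p848642 (no sorry); head `Db_T_of_organsW1 : ‹O1-W1› → ‹O2› → DbTSAtRecordW1` PROVED, concluding
★ `piSCompletion_isThetaTypeAtCMTestSignedW1` (p848883); `Db_T_paidW1` goes through the single sorry (O2♭); monotonicity `dbTSAtRecord_toW1 : DbTSAtRecord →
DbTSAtRecordW1` (★ `…TestSigned_toW1` by name) certifies the W1 head is WEAKER.  File sorries = {(O1) (road-S head only), (O2♭)}.
ED. 6 «β» (832f41067d1f4a77, WRITTEN commit 1201edd58253, BUILT req414; LH10-plan (g2)): THE RIGIDITY ORGAN IS CUT TO ITS CONSUMED CLAUSE.  Both heads apply the rigidity organ ONLY at (O1)'s SUPERCUSPIDAL theta constituent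
`c₀`, so clause (α) of (O2♭) («no `π² ∘ e` constituent») and the `πⁿ ∘ e`-branch of (O2) were never in the cone.  New organ (O2♮) `StubXiPacketRigidCoreSc` := (O2♭)'s
binders VERBATIM + clause (β) ALONE (§1, new `def`; the `def`s (O1), (O2), (O2♭), `DbTSAtRecord`, (O1-W1), `DbTSAtRecordW1` are BYTE-UNCHANGED); §2: the sorried organ
is now `stub_xiPacketRigidCoreSc` (O2♮) — `stub_xiPacketRigidCore` (O2♭) is NO LONGER sorried or declared as a closed theorem, its ED. 4 peel survives in hypothesis
form `stubXiPacketRigidAtRecord_of_core`; ★ monotonicity `stubXiPacketRigidCoreSc_of_core : ‹O2♭› → ‹O2♮›` (projection) and `stubXiPacketRigidCoreSc_of_atRecord :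
‹O2› → ‹O2♮›` (Ne-glue) kernel-certify WEAKER; §3∕§4: new heads `Db_T_of_organsSc : ‹O1› → ‹O2♮› → DbTSAtRecord` and `Db_T_of_organsW1Sc : ‹O1-W1› → ‹O2♮› →
DbTSAtRecordW1` PROVED (three lines each), `Db_T_paid` ∕ `Db_T_paidW1` re-pointed through them (same statements); the ED. 3–5 heads `Db_T_of_organs` ∕
`Db_T_of_organsW1` (hypothesis form over (O2)) stay verbatim.  File sorries = {`stub_thetaLiftMember` (O1, road-S head only), `stub_xiPacketRigidCoreSc` (O2♮)};
W1 road = ONE print clause.  Count-neutral on the books; the LH10 print debt SHRINKS by clause (α).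
ED. 7 «β-doc» (LH10-plan (g2) draft 74415613793fcf08, folded into this edition unchanged; DOC-ONLY over ED. 6 — every declaration byte-identical, same 21 decls, same 2 sorried organs): (i) lit4 W-1461 pin of record applied to the three
Rogawski composites of (O2♮) ∕ HEAD-β ∕ HEAD-W1-β («§14.6 Thm. 14.6.1 p. 241; Thm. 14.6.4 p. 243; pp. 241–245»); (ii) the header's Day-X sentence re-pointed from «B2 discharges
the pins BY NAME» to the rung-0 RECORD fields `Rung0Choice.{hΔ, hcan₀, hex₀}` of closer edition «Δ‴-PINS EXPOSED» (LHref-S Day-X rehearsal; desk D69; LEAD T12-35).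
ED. 9 «O1-RETIRE» (LH10-plan (g5), 2026-09-02; LEAD F0P3a-plan (g14) T13-21 RULING «ED. 9 =» 11:43:20Z, conditions (c1)–(c3); desk F0P3-plan words the write): **O1 RETIRED UNCONSUMED — NOT paid.**  The two TERMS `stub_thetaLiftMember` (O1, sorried; consumed only by `Db_T_paid`) and `Db_T_paid : DbTSAtRecord` (the road-S closer-side reading; consumed by nothing at term level since PKΠ v1.16 «DOCK-TW1» docks `Db_T_paidW1`) are retired as block comments.  Road S = `def StubThetaLiftMember` + `def DbTSAtRecord` + the hypothesis-form heads `Db_T_of_organs` ∕ `Db_T_of_organsSc` ∕ `Db_T_of_organs_eq_route` — all KEPT byte-identical; re-activation = one ★ proof of `StubThetaLiftMember` + re-declaring `Db_T_paid` in one line (`theorem Db_T_paid : DbTSAtRecord := Db_T_of_organsSc ‹that proof› stub_xiPacketRigidCoreSc`).  Every other STATEMENT (`DbTSAtRecordW1`, the organs) and head (`Db_T_of_organsW1(Sc)`, `Db_T_paidW1`, `Db_T_of_thetaRoadW1`) byte-identical to ED. 8; no `Lines`∕`Cruxes` import added (the only import added since ED. 6 is ★ `Theorems.F0P3cDbTThetaRoadW1`,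 ED. 8).  File sorries = {`stub_xiPacketRigidCoreSc` (O2♮) [Rogawski1990 Thm. 13.3.6 (c) + §14.6]} = 1 = row #76's residue of record; `Db_T_paidW1 --axioms` unchanged (TRIO + `sorryAx` via O2♮ only).  Stale-by-name pointers (★ files are not re-opened for docstrings): ★ `Theorems/F0P2oD7alphaMemDockOfRowsSCDSignedW1W.lean` and PKΠ `Lines/F0_P2PKPiRung4.lean` v1.16 name `Db_T_paid` as the «road-S fallback twin» — that term no longer exists after this edition (it carried `sorryAx` via O1 anyway).

ED. 8 «β-doc + Θ-hook» (this; LH10-plan (g3)): ED. 7's doc-only pins (i)(ii) + ONE import (★ `Theorems/F0P3cDbTThetaRoadW1`, p850793) + §5 = ONE theorem in HYPOTHESIS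
form, `Db_T_of_thetaRoadW1 : ‹O2θ-W1› → DbTSAtRecordW1 := F0P3cDbTThetaRoadW1.dbTSAtRecordW1_of_thetaRoad` (δ-unfolding).  SORRY-NEUTRAL (2 = 2: the Θ-organ is a
hypothesis here, never sorried in this file); every ED. 6 declaration byte-identical (21 → 22 decls); `Db_T_paid` ∕ `Db_T_paidW1` (the Day-X term of record) untouched.
WHY: (O2♮) is GLOBAL rigidity for the inner form `U(H)` [Rogawski1990 Thm. 13.3.6 (c) + §14.6] with no count-positive in-house road (★ `MemXiFamily` is an envelope; no
by-name bridge to LH7 ORGAN 2; `CharIdentityAtTest` is the full distributional identity); the ONE alternative typing of the W1 residual is LOCAL — (O2θ-W1) «every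
SUPERCUSPIDAL theta type `X_v(μ,ε,χ_f) ∘ κ_v⁻¹` of DICT-tied CM data completes `πⁿ(ξ_v) ∘ e` in the SIGNED (13.1.4) on test functions» [GelbartRogawski1991 (5.1.1),
Lem. 5.1.2 p. 466 (πˢ-half); Rogawski1990 Prop. 13.1.3 (d), 13.1.4 p. 199] — no `P`, no `μA`, no §13.3 ∕ §14.6; PRINT, count-neutral (GR91's own proof of 5.1.2 is global:
[R₂] + Thm. 5.1.1, Remark p. 466).  §5 records that road IN the served leaf so the record shows both typings of the residual side by side; which one a books row
cites is the desk's ∕ LEAD's call, not this file's.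

## THE ORGANS (organ ↦ page; (O1): road B of record, road A = [GR91] §3.4 global theta on the automorphic locus; (O2): [R90] §13.3)
* `stub_thetaLiftMember` **(O1) «GLOBAL THETA MEMBER WITH PRESCRIBED NON-SPLIT CLASS»** [GelbartRogawski1991 §3.4 Prop. 3.4.1 (1)(2) pp. 459–460 («Θ(γ,ψ) ⊂ L²»; «for any χ the
  closure of Θ(γ,ψ,χ) generates a non-zero irreducible automorphic representation» ω(γ,ψ,χ)), Thm. 3.4 (a) p. 461 («ω(γ,ψ,χ) ∈ Π(ϱ)», ϱ by (3.4.2) = (5.1.1) p. 465), Lem. 5.1.2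
  proof p. 466 («ω(γ_v,ψ′_v,χ_v) differs from ω(γ_v,ψ_v,χ_v) precisely at the places of X» — the other class is the supercuspidal member); Rogawski1990 Prop. 13.1.3 (d) p. 199,
  §14.6 pp. 242–245 (inner forms)]: for the head's `ξ`, a DICT-tied pair `(μ, χ_f)` and a non-split `v` there are a GLOBAL line class `ε ∈ (L⁺)ˣ`, an automorphic measure and a
  DISCRETE automorphic `P` of `U(H)(𝔸)` in the ξ-local family (★ `MemXiFamily`, D6 envelope currency) having a `v`-constituent, ALL of whose `v`-constituents are SUPERCUSPIDAL
  and of theta type `X_v(μ, ε, χ_f) ∘ κ_v⁻¹` (★ `ThetaTypeAtCM`).  PRINT: `P := ω(γ, ψ^ε, χ)` the global Weil representation for a line `ε` in the supercuspidal class at `v`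
  (★ `F0P3cDbTThetaPairAtLabel`, LH10-p01 p848036) and of the occurring sign at the definite real places (weak approximation); in-house road visible: ★ S2♯-θ
  `F0P2uS2SharpTheta.memXiFamily_of_theta_of_clauses` + ★ `F0P2uMemXiFamilyThetaNonsplit` + ★ CUSP-DICT reduce it to the EXISTENCE of a discrete `P` with
  `P.HasFinComponent (rhoAtLine … ε χ)` (= Prop. 3.4.1 on `U(H)`).  A2: hypotheses satisfiable (the closer's `(μ, χ_f)` of record; ★ `F0P2uXiOfThetaDatum.exists_xi_dictionary`);
  A5: not stronger than print — `∃ ε` absorbs the inner-form occurrence condition, every other clause is Thm. 3.4 (a) read constituent-wise.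
* `stub_xiPacketRigidAtRecord` **(O2) «RIGIDITY OF Π(ξ) AT A NON-SPLIT PLACE, RECORD CURRENCY, SIGNED»** [Rogawski1990 Thm. 13.3.6 (c) + Thm. 13.3.5, §13.3 pp. 201–203 («if π′
  is discrete with π′_v = πⁿ(ξ_v) for some non-split v then π′ ∈ Π(ξ)»; Π(ξ) = {⊗π_v : π_v ∈ Π(ξ_v)}), §12.2 (2) p. 174 (πⁿ is the unramified constituent), Prop. 13.1.3 (d) +
  (13.1.4) p. 199 (Π(ξ_v) = {πⁿ, πˢ}, `χ_{πⁿ} + χ_{πˢ} = ξ_v ∘ transfer`), §4.9 p. 55 + [LanglandsShelstad1987 §1] (normalisation ⇒ the sign `ε_v(a)` at `Δ‴`, RULING «K»),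
  §14.6 pp. 242–245 (inner forms)]: at PRINT'S data — `Δ = Δ‴` (`hΔ`), canonical orbital measures (`hcan`), Haar `ν_G, ν_H` — carrying the SIGNED package for every `ξ`
  (`hQS`) and (H₇): for every discrete `P` with
  `MemXiFamily P … ξ`, every non-split `v`, frame `(T, a)`, Haar `μZ`, Keys labels `(π², πⁿ)` with `πⁿ` not square-integrable, EVERY `v`-constituent `c` of `P` is `πⁿ ∘ e` OR
  completes `πⁿ ∘ e` in the SIGNED (13.1.4) on test functions at `ξ_v = ξ.xiLocalChar v`.  PRINT: the envelope gives `P_w = πⁿ(ξ_w)` for almost all `w`, 13.3.6 (c) puts `P` in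
  `Π′(ξ)`, so `c ∈ {πⁿ(ξ_v), πˢ(ξ_v)} ∘ e`; `πˢ(ξ_v) ∘ e` IS the `hQS`-completion (13.1.4 at `Δ‴` = the signed identity; (H₇) + ★ `linearIndependent_smoothTrace` pin it; ★
  `eq_of_charIdentityAtTest`).  A2: satisfiable at the closer's record (`Rung0Choice.hQ`, `htE`, `W.νG` Haar); A5: print's rigidity read in D6 currency, no theta content.
* `stub_xiPacketRigidCore` **(O2♭) «THE 13.3.6 (c) CORE»** (ED. 4; LH10-p01's cut, ★ p848339∕p848467): same binders as (O2); (α) no `v`-constituent of `P` is `π² ∘ e`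
  [Rogawski1990 Thm. 13.3.6 (c) + 13.3.5: `P ∈ Π(ξ)`, and `π²(ξ_v) ∉ Π(ξ_v)` — §12.2, Prop. 13.1.3 (d) p. 199]; (β) every SUPERCUSPIDAL `v`-constituent (hence `= πˢ(ξ_v) ∘ e`)
  completes `πⁿ ∘ e` in the SIGNED (13.1.4) [Prop. 13.1.4 p. 199 at `Δ‴`, §4.9 p. 55].  (O2) := ★ peel((O2♭)) by the pin-free envelope trichotomy (`c = πⁿ∘e ∨ c = π²∘e ∨ c`
  supercuspidal`, ★ `constituent_trichotomy_of_memXiFamily`).  A2∕A5 as for (O2): weaker than (O2) only by ★ theorems.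
* `stub_xiPacketRigidCoreSc` **(O2♮) «THE SUPERCUSPIDAL CLAUSE»** (ED. 6 «β»; LH10-plan (g2)): (O2♭)'s binders; (β) only — every SUPERCUSPIDAL `v`-constituent `c` of `P`
  completes `πⁿ ∘ e` in the SIGNED (13.1.4) on test functions at `ξ.xiLocalChar v` [Rogawski1990 §14.6 Thm. 14.6.1 ∕ 14.6.4 pp. 242–245 (inner forms) over §13.3
  Thm. 13.3.6 (c) + 13.3.5 p. 202: `P ∈ Π′(ξ)` ⇒ `c ∈ {πⁿ(ξ_v), πˢ(ξ_v)} ∘ e`; `c` supercuspidal ⇒ `c = πˢ(ξ_v) ∘ e` (§12.2, Prop. 13.1.3 (d)); Prop. 13.1.4 p. 199 at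
  `Δ‴` (§4.9 p. 55, RULING «K») = the signed identity].  THE sorried rigidity organ since ED. 6; (O2♭) ⟹ (O2♮) and (O2) ⟹ (O2♮) are ★ in §2.  A2∕A5 as for (O2♭).
* GLUE ★ (no stub): `F0P3cStCharTSNe.ne_comap_πn_of_isSupercuspidal` (LH6-p02; LH10-p01 (G-ne) check 10aa50b9e896b77b) — a supercuspidal class is not `πⁿ ∘ e`.
SHRED CHECK: 2 sorried organs ((O1), (O2♮) — ED. 6; (O2♭) until ED. 5-W); neither restates the head ((O1) has no character identity, (O2) no theta type), books rows #86∕#139∕#140∕#159 (WITHDRAWN twins) not touched; both are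
stated over ★ Literature defs only (`MemXiFamily`, `IsConstituentOf`, `ThetaTypeAtCM`, `CMCharIdentityPackageTestSigned`, `IsLocalDeltaTransferExists`, `CharIdentityAtTest`).

## References
* [GelbartRogawski1991] S. Gelbart, J. Rogawski, Invent. Math. 105 (1991): §3.4 Prop. 3.4.1 pp. 459–460, Thm. 3.4 (a), (3.4.2) p. 461; §5.1 (5.1.1), Thm. 5.1.1 p. 465,
  Lem. 5.1.2 p. 466; §5.2 Cor. 5.2.2 p. 467.
* [Rogawski1990] J. Rogawski, Ann. of Math. Stud. 123 (1990): §12.2 (2) p. 174; §13.1 Prop. 13.1.3 (d), (13.1.4) p. 199; §13.3 Thm. 13.3.5, Thm. 13.3.6 (c), Thm. 13.3.7 pp. 201–203;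
  §4.9 p. 55; §14.6 pp. 242–245.
* [Rogawski1992] J. Rogawski, in: The zeta functions of Picard modular surfaces, CRM (1992): Thm. 1.1 p. 396.  [LanglandsShelstad1987] Math. Ann. 278: §1.
-/

set_option autoImplicit false
set_option linter.dupNamespace false

noncomputable section

open NumberField IsDedekindDomain MeasureTheory
open scoped Matrix ComplexOrder

namespace Summit.HodgeConjecture.HodgeConjecture.Cruxes.H413.F0P3cDbTPaydown

open Literature.NumberTheory Literature.NumberTheory.Automorphic Literature.NumberTheory.Automorphic.UnitaryGroup
open Literature.NumberTheory.Automorphic.IdeleClassGroup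
open Literature.NumberTheory.Automorphic.Liu2021 Literature.NumberTheory.Automorphic.Liu2021.Def411WeilCarriers
open Literature.NumberTheory.GaloisRepresentations
open Literature.NumberTheory.Rogawski1990 Literature.NumberTheory.GelbartRogawski1991

/-! ## §1 The organ statements (closed `Prop`s; ★ vocabulary only) -/

/-- **(O1) «Π(ξ)-MEMBER WITH PRESCRIBED SUPERCUSPIDAL CM-THETA CLASS AT A NON-SPLIT PLACE»** — statement (bytes unchanged since ED. 1).  PRINT ROAD OF RECORD =
ROAD B (LHref-S 02:55:37Z (ii), LH10-p02 «AUTOMORPHY GAP» 02:52:49Z): a DISCRETE member of `Π(ξ)` on `U(H)` with `P_v ≅ πˢ(ξ_v)` exists (even `πˢ`-set: `v` and one more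
inert place) and `πˢ(ξ_v) ∘ e` is the CM theta class `X_v(μ, ε, χ_f) ∘ κ_v⁻¹` for `ε` in the supercuspidal class when DICT1∕DICT2 tie `(μ, χ_f)` to `ξ` at `v` — true ON AND
OFF the automorphic locus of `χ_f`; ROAD A (GR91 §3.4 global theta `ω(γ, ψ^ε, χ)`, the tree's Θ-OCC-GEN ∕ S2♯-θ road) pays it on the automorphic weight-one locus only.
[cite: Rogawski1990, §13.3 Thm. 13.3.7 pp. 202–203; §13.1 Prop. 13.1.3 (d) p. 199; §14.6 pp. 242–245] [cite: GelbartRogawski1991, §5.1 Lem. 5.1.2 p. 466; §5.2 Cor. 5.2.2 p. 467; §3.4 Prop. 3.4.1 pp. 459–460, Thm. 3.4 (a) p. 461; §5.1 (5.1.1) p. 465] -/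
def StubThetaLiftMember : Prop :=
  ∀ (L : Type) [Field L] [NumberField L] [IsCMField L] (H : Matrix (Fin 3) (Fin 3) L)
    (hH : (H.map (cmConjRingHom L))ᵀ = H) (hHd : IsUnit H.det) (μω : HeckeCharacter L) (hμu : μω.IsUnitary),
    (∀ x : Literature.NumberTheory.GaloisRepresentations.ideleGroup ↥(maximalRealSubfield L),
      μω (AdeleRing.ideleBaseChange (↥(maximalRealSubfield L)) L x) = quadraticHeckeCharCM L x) →
    ∀ {n' : ℕ} (e₁ : Fin 3 × Fin 1 ≃ Fin n') (dV : Fin 3 → L) (hdV : ∀ i, IsCMField.complexConj L (dV i) = dV i) (hdV0 : ∀ i, dV i ≠ 0)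
      (g : GL (Fin 3) L) (hg : ((g : Matrix (Fin 3) (Fin 3) L).map (cmConjRingHom L))ᵀ * H * (g : Matrix (Fin 3) (Fin 3) L) = Matrix.diagonal dV)
      (ξ : OneDimAutRepH L)
      (μ : Literature.NumberTheory.Automorphic.IdeleClassGroup L →ₜ* Circle) (hμ : IsConjugateSymplectic L μ)
      (χf : UnitaryGroup.finAdelicOne (↥(maximalRealSubfield L)) L (IsCMField.complexConj L) →* ℂˣ),
      Continuous χf → (∀ z, ‖((χf z : ℂˣ) : ℂ)‖ = 1) →
      (∀ v : HeightOneSpectrum (𝓞 ↥(maximalRealSubfield L)),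
          (toHeckeCharacter L μ).semilocalComponent L v = (ξ.bcη⁻¹ * ξ.bcψ⁻¹ * μω).semilocalComponent L v) →
      (∀ z : (FiniteAdeleRing (𝓞 L) L)ˣ,
          χf (finAdelicCheck (↥(maximalRealSubfield L)) L (IsCMField.complexConj L)
              (AlgEquiv.ext fun x => by rw [AlgEquiv.mul_apply, IsCMField.complexConj_apply_apply, AlgEquiv.one_apply]) z) =
            (ξ.bcψ⁻¹ * (ξ.bcη⁻¹ * ξ.bcψ⁻¹ * μω) ^ 2)
              (Units.map (N := AdeleRing (𝓞 L) L) (MonoidHom.inr (InfiniteAdeleRing L) (FiniteAdeleRing (𝓞 L) L)) z)) →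
      ∀ (v : HeightOneSpectrum (𝓞 ↥(maximalRealSubfield L))), (∀ w : PlacesOver L v, IsCMField.complexConj L • w.1 = w.1) →
        ∃ (ε : (↥(maximalRealSubfield L))ˣ)
          (μA : Measure (adelicGroupData (↥(maximalRealSubfield L)) L (IsCMField.complexConj L) 3 H).automorphicQuotient)
          (_ : (adelicGroupData (↥(maximalRealSubfield L)) L (IsCMField.complexConj L) 3 H).IsAutomorphicMeasure μA)
          (P : DiscreteAutomorphicRep (adelicGroupData (↥(maximalRealSubfield L)) L (IsCMField.complexConj L) 3 H) μA),
          MemXiFamily P hH hHd μω hμu ξ ∧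
          (∃ c : IrrClass ((cmDatum L 3 H).Local v),
            (IrrClass.comap (localPiEquiv L (IsCMField.complexConj L) 3 H v) c).IsConstituentOf
              (P.finRep.smoothPart.toRepresentation.comp (inclPlace (↥(maximalRealSubfield L)) L (IsCMField.complexConj L) 3 H v))) ∧
          ∀ c : IrrClass ((cmDatum L 3 H).Local v),
            (IrrClass.comap (localPiEquiv L (IsCMField.complexConj L) 3 H v) c).IsConstituentOf
                (P.finRep.smoothPart.toRepresentation.comp (inclPlace (↥(maximalRealSubfield L)) L (IsCMField.complexConj L) 3 H v)) →
              c.IsSupercuspidal ∧ ThetaTypeAtCM L H e₁ dV hdV hdV0 g hg μ hμ χf ε v c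

open scoped Classical in
/-- **(O2) «RIGIDITY OF Π(ξ) AT A NON-SPLIT PLACE, RECORD CURRENCY, SIGNED»** — statement.  [cite: Rogawski1990, §13.3 Thm. 13.3.5, Thm. 13.3.6 (c) pp. 201–203; §12.2 (2) p. 174; §13.1 Prop. 13.1.3 (d), Prop. 13.1.4 p. 199; §4.9 p. 55; §14.6 pp. 242–245] [cite: LanglandsShelstad1987, §1] -/
def StubXiPacketRigidAtRecord : Prop :=
  ∀ (L : Type) [Field L] [NumberField L] [IsCMField L] (H : Matrix (Fin 3) (Fin 3) L)
    (hH : (H.map (cmConjRingHom L))ᵀ = H) (hHd : IsUnit H.det)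
    [∀ v : HeightOneSpectrum (𝓞 ↥(maximalRealSubfield L)), MeasurableSpace ((cmDatum L 3 H).Local v)]
    [∀ v : HeightOneSpectrum (𝓞 ↥(maximalRealSubfield L)),
      MeasurableSpace ((cmDatum L 2 (Matrix.of fun i j : Fin 2 => if i.val + j.val + 1 = 2 then (1 : L) else 0)).Local v ×
        (cmDatum L 1 (Matrix.of fun i j : Fin 1 => if i.val + j.val + 1 = 1 then (1 : L) else 0)).Local v)]
    [∀ (v : HeightOneSpectrum (𝓞 ↥(maximalRealSubfield L)))
        (a : ((cmDatum L 2 (Matrix.of fun i j : Fin 2 => if i.val + j.val + 1 = 2 then (1 : L) else 0)).Local v ×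
          (cmDatum L 1 (Matrix.of fun i j : Fin 1 => if i.val + j.val + 1 = 1 then (1 : L) else 0)).Local v)),
      MeasurableSpace (((cmDatum L 2 (Matrix.of fun i j : Fin 2 => if i.val + j.val + 1 = 2 then (1 : L) else 0)).Local v ×
          (cmDatum L 1 (Matrix.of fun i j : Fin 1 => if i.val + j.val + 1 = 1 then (1 : L) else 0)).Local v) ⧸
        Subgroup.centralizer ({a} : Set ((cmDatum L 2 (Matrix.of fun i j : Fin 2 => if i.val + j.val + 1 = 2 then (1 : L) else 0)).Local v ×
          (cmDatum L 1 (Matrix.of fun i j : Fin 1 => if i.val + j.val + 1 = 1 then (1 : L) else 0)).Local v)))]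
    [∀ (v : HeightOneSpectrum (𝓞 ↥(maximalRealSubfield L))) (γ : (cmDatum L 3 H).Local v),
      MeasurableSpace ((cmDatum L 3 H).Local v ⧸ Subgroup.centralizer ({γ} : Set ((cmDatum L 3 H).Local v)))]
    (Δ : ∀ v : HeightOneSpectrum (𝓞 ↥(maximalRealSubfield L)), LocalTransferFactor L H v)
    (mH : ∀ v : HeightOneSpectrum (𝓞 ↥(maximalRealSubfield L)),
      OrbitalMeasureFamily ((cmDatum L 2 (Matrix.of fun i j : Fin 2 => if i.val + j.val + 1 = 2 then (1 : L) else 0)).Local v ×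
        (cmDatum L 1 (Matrix.of fun i j : Fin 1 => if i.val + j.val + 1 = 1 then (1 : L) else 0)).Local v))
    (mG : ∀ v : HeightOneSpectrum (𝓞 ↥(maximalRealSubfield L)), OrbitalMeasureFamily ((cmDatum L 3 H).Local v))
    (νG : ∀ v : HeightOneSpectrum (𝓞 ↥(maximalRealSubfield L)), Measure ((cmDatum L 3 H).Local v))
    (νH : ∀ v : HeightOneSpectrum (𝓞 ↥(maximalRealSubfield L)),
      Measure ((cmDatum L 2 (Matrix.of fun i j : Fin 2 => if i.val + j.val + 1 = 2 then (1 : L) else 0)).Local v ×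
        (cmDatum L 1 (Matrix.of fun i j : Fin 1 => if i.val + j.val + 1 = 1 then (1 : L) else 0)).Local v))
    [∀ v : HeightOneSpectrum (𝓞 ↥(maximalRealSubfield L)), BorelSpace ((cmDatum L 3 H).Local v)]
    [∀ v : HeightOneSpectrum (𝓞 ↥(maximalRealSubfield L)),
      BorelSpace ((cmDatum L 2 (Matrix.of fun i j : Fin 2 => if i.val + j.val + 1 = 2 then (1 : L) else 0)).Local v ×
        (cmDatum L 1 (Matrix.of fun i j : Fin 1 => if i.val + j.val + 1 = 1 then (1 : L) else 0)).Local v)]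
    [∀ (v : HeightOneSpectrum (𝓞 ↥(maximalRealSubfield L)))
        (a : ((cmDatum L 2 (Matrix.of fun i j : Fin 2 => if i.val + j.val + 1 = 2 then (1 : L) else 0)).Local v ×
          (cmDatum L 1 (Matrix.of fun i j : Fin 1 => if i.val + j.val + 1 = 1 then (1 : L) else 0)).Local v)),
      BorelSpace (((cmDatum L 2 (Matrix.of fun i j : Fin 2 => if i.val + j.val + 1 = 2 then (1 : L) else 0)).Local v ×
          (cmDatum L 1 (Matrix.of fun i j : Fin 1 => if i.val + j.val + 1 = 1 then (1 : L) else 0)).Local v) ⧸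
        Subgroup.centralizer ({a} : Set ((cmDatum L 2 (Matrix.of fun i j : Fin 2 => if i.val + j.val + 1 = 2 then (1 : L) else 0)).Local v ×
          (cmDatum L 1 (Matrix.of fun i j : Fin 1 => if i.val + j.val + 1 = 1 then (1 : L) else 0)).Local v)))]
    [∀ (v : HeightOneSpectrum (𝓞 ↥(maximalRealSubfield L))) (γ : (cmDatum L 3 H).Local v),
      BorelSpace ((cmDatum L 3 H).Local v ⧸ Subgroup.centralizer ({γ} : Set ((cmDatum L 3 H).Local v)))]
    [∀ v, (νG v).IsHaarMeasure] [∀ v, (νG v).IsMulRightInvariant] [∀ v, (νH v).IsHaarMeasure] [∀ v, (νH v).IsMulRightInvariant],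
    ∀ (μω : HeckeCharacter L) (hμu : μω.IsUnitary),
    (∀ x : Literature.NumberTheory.GaloisRepresentations.ideleGroup ↥(maximalRealSubfield L),
      μω (AdeleRing.ideleBaseChange (↥(maximalRealSubfield L)) L x) = quadraticHeckeCharCM L x) →
    Δ = finExplicitCollection L H μω (finExplicitDelta_conj_left_all L H μω) (finExplicitDelta_conj_right_all L H μω) →
    (∀ v : HeightOneSpectrum (𝓞 ↥(maximalRealSubfield L)), (mH v).IsCanonical (IsLocalGRegular L v) (νH v) ∧
      (mG v).IsCanonical (fun γ => IsRegularElt (γ.val : GL (Fin 3) (UnitaryGroup.LocalRing L v))) (νG v)) →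
    CMCharIdentityPackageTestSigned L H hH hHd νH νG μω hμu Δ mH mG →
    (∀ v : HeightOneSpectrum (𝓞 ↥(maximalRealSubfield L)), (∀ w : PlacesOver L v, IsCMField.complexConj L • w.1 = w.1) →
      IsLocalDeltaTransferExists L H v (Δ v) (mH v) (mG v) Literature.NumberTheory.Rogawski1990.IsLocSmooth
        Literature.NumberTheory.Rogawski1990.IsLocSmooth) →
    ∀ (ξ : OneDimAutRepH L)
      (μA : Measure (adelicGroupData (↥(maximalRealSubfield L)) L (IsCMField.complexConj L) 3 H).automorphicQuotient)
      [(adelicGroupData (↥(maximalRealSubfield L)) L (IsCMField.complexConj L) 3 H).IsAutomorphicMeasure μA]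
      (P : DiscreteAutomorphicRep (adelicGroupData (↥(maximalRealSubfield L)) L (IsCMField.complexConj L) 3 H) μA),
      MemXiFamily P hH hHd μω hμu ξ →
      ∀ (v : HeightOneSpectrum (𝓞 ↥(maximalRealSubfield L))), (∀ w : PlacesOver L v, IsCMField.complexConj L • w.1 = w.1) →
      ∀ (T : GL (Fin 3) (LocalRing L v)) (a : LocalRing L v) (ha : IsUnit a)
        (h : formCongr (conjLocal L (IsCMField.complexConj L) v) T (H.map (algebraMap L (LocalRing L v))) =
          a • (Matrix.of fun i j : Fin 3 => if i.val + j.val + 1 = 3 then (1 : L) else 0).map (algebraMap L (LocalRing L v))),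
      ∀ [MeasurableSpace (Gqs L v ⧸ Subgroup.center (Gqs L v))] [BorelSpace (Gqs L v ⧸ Subgroup.center (Gqs L v))]
        (μZ : Measure (Gqs L v ⧸ Subgroup.center (Gqs L v))) [μZ.IsHaarMeasure],
      ∀ (π2 πn : IrrClass (Gqs L v)),
        KeysCaseTwoLabels L v (μω.semilocalComponent L v) (torusLocalComponent L (IsCMField.complexConj L) v ξ.η)
          (torusLocalComponent L (IsCMField.complexConj L) v ξ.ψ) π2 πn →
        ¬ πn.IsSquareIntegrable μZ →
        ∀ c : IrrClass ((cmDatum L 3 H).Local v),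
          (IrrClass.comap (localPiEquiv L (IsCMField.complexConj L) 3 H v) c).IsConstituentOf
              (P.finRep.smoothPart.toRepresentation.comp (inclPlace (↥(maximalRealSubfield L)) L (IsCMField.complexConj L) 3 H v)) →
          c = IrrClass.comap (cmDatumLocalCongr L v T ha h).symm πn ∨
            (⟨IrrClass.comap (cmDatumLocalCongr L v T ha h).symm πn, some c⟩ : CMLocalAPacket L H v).CharIdentityAtTest L H v
              (fun c' f => (if ∃ z : LocalRing L v, IsUnit z ∧ a = z * conjLocal L (IsCMField.complexConj L) v z then (1 : ℂ) else -1) *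
                c'.smoothTrace (νG v) f)
              (ξ.xiLocalChar v) (νH v) (Δ v) (mH v) (mG v)

open scoped Classical in
/-- **(O2♭) «THE 13.3.6 (c) CORE OF (O2) AT PRINT'S PINNED DATA»** — statement = the HYPOTHESIS of ★ `F0P3cDbTEnvelopePeelPinned.stubXiPacketRigidAtRecord_of_core_pinned`
(LH10-p01 p848467, :56–:132) VERBATIM: the (O2) binders, then (α) no `v`-constituent of `P` is `π² ∘ e`; (β) every SUPERCUSPIDAL `v`-constituent completes `πⁿ ∘ e` in the
SIGNED (13.1.4) on test functions at `ξ.xiLocalChar v`.  (O2) = (O2♭) + the pin-free envelope trichotomy ★ `F0P3cDbTEnvelopeTrichotomy.constituent_trichotomy_of_memXiFamily`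
(p848339).  [cite: Rogawski1990, §13.3 Thm. 13.3.5, Thm. 13.3.6 (c) pp. 201–203; §12.2 (2) p. 174; §13.1 Prop. 13.1.3 (d), Prop. 13.1.4 p. 199; §4.9 p. 55; §14.6 pp. 242–245] [cite: LanglandsShelstad1987, §1] -/
def StubXiPacketRigidCore : Prop :=
  ∀ (L : Type) [Field L] [NumberField L] [IsCMField L] (H : Matrix (Fin 3) (Fin 3) L)
    (hH : (H.map (cmConjRingHom L))ᵀ = H) (hHd : IsUnit H.det)
    [∀ v : HeightOneSpectrum (𝓞 ↥(maximalRealSubfield L)), MeasurableSpace ((cmDatum L 3 H).Local v)]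
    [∀ v : HeightOneSpectrum (𝓞 ↥(maximalRealSubfield L)),
      MeasurableSpace ((cmDatum L 2 (Matrix.of fun i j : Fin 2 => if i.val + j.val + 1 = 2 then (1 : L) else 0)).Local v ×
        (cmDatum L 1 (Matrix.of fun i j : Fin 1 => if i.val + j.val + 1 = 1 then (1 : L) else 0)).Local v)]
    [∀ (v : HeightOneSpectrum (𝓞 ↥(maximalRealSubfield L)))
        (a : ((cmDatum L 2 (Matrix.of fun i j : Fin 2 => if i.val + j.val + 1 = 2 then (1 : L) else 0)).Local v ×
          (cmDatum L 1 (Matrix.of fun i j : Fin 1 => if i.val + j.val + 1 = 1 then (1 : L) else 0)).Local v)),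
      MeasurableSpace (((cmDatum L 2 (Matrix.of fun i j : Fin 2 => if i.val + j.val + 1 = 2 then (1 : L) else 0)).Local v ×
          (cmDatum L 1 (Matrix.of fun i j : Fin 1 => if i.val + j.val + 1 = 1 then (1 : L) else 0)).Local v) ⧸
        Subgroup.centralizer ({a} : Set ((cmDatum L 2 (Matrix.of fun i j : Fin 2 => if i.val + j.val + 1 = 2 then (1 : L) else 0)).Local v ×
          (cmDatum L 1 (Matrix.of fun i j : Fin 1 => if i.val + j.val + 1 = 1 then (1 : L) else 0)).Local v)))]
    [∀ (v : HeightOneSpectrum (𝓞 ↥(maximalRealSubfield L))) (γ : (cmDatum L 3 H).Local v),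
      MeasurableSpace ((cmDatum L 3 H).Local v ⧸ Subgroup.centralizer ({γ} : Set ((cmDatum L 3 H).Local v)))]
    (Δ : ∀ v : HeightOneSpectrum (𝓞 ↥(maximalRealSubfield L)), LocalTransferFactor L H v)
    (mH : ∀ v : HeightOneSpectrum (𝓞 ↥(maximalRealSubfield L)),
      OrbitalMeasureFamily ((cmDatum L 2 (Matrix.of fun i j : Fin 2 => if i.val + j.val + 1 = 2 then (1 : L) else 0)).Local v ×
        (cmDatum L 1 (Matrix.of fun i j : Fin 1 => if i.val + j.val + 1 = 1 then (1 : L) else 0)).Local v))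
    (mG : ∀ v : HeightOneSpectrum (𝓞 ↥(maximalRealSubfield L)), OrbitalMeasureFamily ((cmDatum L 3 H).Local v))
    (νG : ∀ v : HeightOneSpectrum (𝓞 ↥(maximalRealSubfield L)), Measure ((cmDatum L 3 H).Local v))
    (νH : ∀ v : HeightOneSpectrum (𝓞 ↥(maximalRealSubfield L)),
      Measure ((cmDatum L 2 (Matrix.of fun i j : Fin 2 => if i.val + j.val + 1 = 2 then (1 : L) else 0)).Local v ×
        (cmDatum L 1 (Matrix.of fun i j : Fin 1 => if i.val + j.val + 1 = 1 then (1 : L) else 0)).Local v))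
    [∀ v : HeightOneSpectrum (𝓞 ↥(maximalRealSubfield L)), BorelSpace ((cmDatum L 3 H).Local v)]
    [∀ v : HeightOneSpectrum (𝓞 ↥(maximalRealSubfield L)),
      BorelSpace ((cmDatum L 2 (Matrix.of fun i j : Fin 2 => if i.val + j.val + 1 = 2 then (1 : L) else 0)).Local v ×
        (cmDatum L 1 (Matrix.of fun i j : Fin 1 => if i.val + j.val + 1 = 1 then (1 : L) else 0)).Local v)]
    [∀ (v : HeightOneSpectrum (𝓞 ↥(maximalRealSubfield L)))
        (a : ((cmDatum L 2 (Matrix.of fun i j : Fin 2 => if i.val + j.val + 1 = 2 then (1 : L) else 0)).Local v ×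
          (cmDatum L 1 (Matrix.of fun i j : Fin 1 => if i.val + j.val + 1 = 1 then (1 : L) else 0)).Local v)),
      BorelSpace (((cmDatum L 2 (Matrix.of fun i j : Fin 2 => if i.val + j.val + 1 = 2 then (1 : L) else 0)).Local v ×
          (cmDatum L 1 (Matrix.of fun i j : Fin 1 => if i.val + j.val + 1 = 1 then (1 : L) else 0)).Local v) ⧸
        Subgroup.centralizer ({a} : Set ((cmDatum L 2 (Matrix.of fun i j : Fin 2 => if i.val + j.val + 1 = 2 then (1 : L) else 0)).Local v ×
          (cmDatum L 1 (Matrix.of fun i j : Fin 1 => if i.val + j.val + 1 = 1 then (1 : L) else 0)).Local v)))]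
    [∀ (v : HeightOneSpectrum (𝓞 ↥(maximalRealSubfield L))) (γ : (cmDatum L 3 H).Local v),
      BorelSpace ((cmDatum L 3 H).Local v ⧸ Subgroup.centralizer ({γ} : Set ((cmDatum L 3 H).Local v)))]
    [∀ v, (νG v).IsHaarMeasure] [∀ v, (νG v).IsMulRightInvariant] [∀ v, (νH v).IsHaarMeasure] [∀ v, (νH v).IsMulRightInvariant],
    ∀ (μω : HeckeCharacter L) (hμu : μω.IsUnitary),
    (∀ x : Literature.NumberTheory.GaloisRepresentations.ideleGroup ↥(maximalRealSubfield L),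
      μω (AdeleRing.ideleBaseChange (↥(maximalRealSubfield L)) L x) = quadraticHeckeCharCM L x) →
    Δ = finExplicitCollection L H μω (finExplicitDelta_conj_left_all L H μω) (finExplicitDelta_conj_right_all L H μω) →
    (∀ v : HeightOneSpectrum (𝓞 ↥(maximalRealSubfield L)), (mH v).IsCanonical (IsLocalGRegular L v) (νH v) ∧
      (mG v).IsCanonical (fun γ => IsRegularElt (γ.val : GL (Fin 3) (UnitaryGroup.LocalRing L v))) (νG v)) →
    CMCharIdentityPackageTestSigned L H hH hHd νH νG μω hμu Δ mH mG →
    (∀ v : HeightOneSpectrum (𝓞 ↥(maximalRealSubfield L)), (∀ w : PlacesOver L v, IsCMField.complexConj L • w.1 = w.1) →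
      IsLocalDeltaTransferExists L H v (Δ v) (mH v) (mG v) Literature.NumberTheory.Rogawski1990.IsLocSmooth
        Literature.NumberTheory.Rogawski1990.IsLocSmooth) →
    ∀ (ξ : OneDimAutRepH L)
      (μA : Measure (adelicGroupData (↥(maximalRealSubfield L)) L (IsCMField.complexConj L) 3 H).automorphicQuotient)
      [(adelicGroupData (↥(maximalRealSubfield L)) L (IsCMField.complexConj L) 3 H).IsAutomorphicMeasure μA]
      (P : DiscreteAutomorphicRep (adelicGroupData (↥(maximalRealSubfield L)) L (IsCMField.complexConj L) 3 H) μA),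
      MemXiFamily P hH hHd μω hμu ξ →
      ∀ (v : HeightOneSpectrum (𝓞 ↥(maximalRealSubfield L))), (∀ w : PlacesOver L v, IsCMField.complexConj L • w.1 = w.1) →
      ∀ (T : GL (Fin 3) (LocalRing L v)) (a : LocalRing L v) (ha : IsUnit a)
        (h : formCongr (conjLocal L (IsCMField.complexConj L) v) T (H.map (algebraMap L (LocalRing L v))) =
          a • (Matrix.of fun i j : Fin 3 => if i.val + j.val + 1 = 3 then (1 : L) else 0).map (algebraMap L (LocalRing L v))),
      ∀ [MeasurableSpace (Gqs L v ⧸ Subgroup.center (Gqs L v))] [BorelSpace (Gqs L v ⧸ Subgroup.center (Gqs L v))]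
        (μZ : Measure (Gqs L v ⧸ Subgroup.center (Gqs L v))) [μZ.IsHaarMeasure],
      ∀ (π2 πn : IrrClass (Gqs L v)),
        KeysCaseTwoLabels L v (μω.semilocalComponent L v) (torusLocalComponent L (IsCMField.complexConj L) v ξ.η)
          (torusLocalComponent L (IsCMField.complexConj L) v ξ.ψ) π2 πn →
        ¬ πn.IsSquareIntegrable μZ →
        -- (α) «π²(ξ_v) ∘ e is NOT a v-constituent of P»
        (∀ c : IrrClass ((cmDatum L 3 H).Local v),
          (IrrClass.comap (localPiEquiv L (IsCMField.complexConj L) 3 H v) c).IsConstituentOf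
              (P.finRep.smoothPart.toRepresentation.comp (inclPlace (↥(maximalRealSubfield L)) L (IsCMField.complexConj L) 3 H v)) →
          c ≠ IrrClass.comap (cmDatumLocalCongr L v T ha h).symm π2) ∧
        -- (β) «every SUPERCUSPIDAL v-constituent of P completes πⁿ ∘ e in the SIGNED (13.1.4) on test functions»
        (∀ c : IrrClass ((cmDatum L 3 H).Local v),
          (IrrClass.comap (localPiEquiv L (IsCMField.complexConj L) 3 H v) c).IsConstituentOf
              (P.finRep.smoothPart.toRepresentation.comp (inclPlace (↥(maximalRealSubfield L)) L (IsCMField.complexConj L) 3 H v)) →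
          c.IsSupercuspidal →
          (⟨IrrClass.comap (cmDatumLocalCongr L v T ha h).symm πn, some c⟩ : CMLocalAPacket L H v).CharIdentityAtTest L H v
          (fun c' f => (if ∃ z : LocalRing L v, IsUnit z ∧ a = z * conjLocal L (IsCMField.complexConj L) v z then (1 : ℂ) else -1) *
          c'.smoothTrace (νG v) f)
          (ξ.xiLocalChar v) (νH v) (Δ v) (mH v) (mG v))

open scoped Classical in
/-- **(O2♮) «THE SUPERCUSPIDAL CLAUSE OF 13.3.6 (c) ∕ §14.6 AT PRINT'S PINNED DATA»** (ED. 6 «β»; LH10-plan (g2)) — statement = (O2♭)'s binders VERBATIM, then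
clause (β) ALONE: every SUPERCUSPIDAL `v`-constituent `c` of a discrete `Π(ξ)`-family member `P` of the inner form `U(H)` makes `⟨πⁿ(ξ_v) ∘ e, some c⟩` satisfy the
SIGNED (13.1.4) on test functions at `ξ.xiLocalChar v` (print: `P ∈ Π′(ξ)` [§14.6 Thm. 14.6.1 ∕ 14.6.4 over §13.3 Thm. 13.3.6 (c)], so `c ∈ Π(ξ_v) ∘ e = {πⁿ, πˢ} ∘ e`;
`c` supercuspidal ⇒ `c = πˢ(ξ_v) ∘ e`; and `χ_{πⁿ} + χ_{πˢ} = ξ_v ∘ transfer` SIGNED at `Δ‴` [Prop. 13.1.4, §4.9]).  Clause (α) of (O2♭) («no `π² ∘ e` constituent»)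
is NOT in the cone of either head — both heads apply the rigidity organ only at (O1)'s SUPERCUSPIDAL theta constituent, where `π² ∘ e` never occurs — so (α) leaves the
line's print debt.  WEAKER than (O2♭) (★ `stubXiPacketRigidCoreSc_of_core`, a projection) and than (O2) (★ `stubXiPacketRigidCoreSc_of_atRecord`, via the ★ Ne-glue).
[cite: Rogawski1990, §13.3 Thm. 13.3.5, Thm. 13.3.6 (c) pp. 201–203; §13.1 Prop. 13.1.3 (d), Prop. 13.1.4 p. 199; §4.9 p. 55; §14.6 pp. 242–245] [cite: LanglandsShelstad1987, §1] -/
def StubXiPacketRigidCoreSc : Prop :=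
  ∀ (L : Type) [Field L] [NumberField L] [IsCMField L] (H : Matrix (Fin 3) (Fin 3) L)
    (hH : (H.map (cmConjRingHom L))ᵀ = H) (hHd : IsUnit H.det)
    [∀ v : HeightOneSpectrum (𝓞 ↥(maximalRealSubfield L)), MeasurableSpace ((cmDatum L 3 H).Local v)]
    [∀ v : HeightOneSpectrum (𝓞 ↥(maximalRealSubfield L)),
      MeasurableSpace ((cmDatum L 2 (Matrix.of fun i j : Fin 2 => if i.val + j.val + 1 = 2 then (1 : L) else 0)).Local v ×
        (cmDatum L 1 (Matrix.of fun i j : Fin 1 => if i.val + j.val + 1 = 1 then (1 : L) else 0)).Local v)]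
    [∀ (v : HeightOneSpectrum (𝓞 ↥(maximalRealSubfield L)))
        (a : ((cmDatum L 2 (Matrix.of fun i j : Fin 2 => if i.val + j.val + 1 = 2 then (1 : L) else 0)).Local v ×
          (cmDatum L 1 (Matrix.of fun i j : Fin 1 => if i.val + j.val + 1 = 1 then (1 : L) else 0)).Local v)),
      MeasurableSpace (((cmDatum L 2 (Matrix.of fun i j : Fin 2 => if i.val + j.val + 1 = 2 then (1 : L) else 0)).Local v ×
          (cmDatum L 1 (Matrix.of fun i j : Fin 1 => if i.val + j.val + 1 = 1 then (1 : L) else 0)).Local v) ⧸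
        Subgroup.centralizer ({a} : Set ((cmDatum L 2 (Matrix.of fun i j : Fin 2 => if i.val + j.val + 1 = 2 then (1 : L) else 0)).Local v ×
          (cmDatum L 1 (Matrix.of fun i j : Fin 1 => if i.val + j.val + 1 = 1 then (1 : L) else 0)).Local v)))]
    [∀ (v : HeightOneSpectrum (𝓞 ↥(maximalRealSubfield L))) (γ : (cmDatum L 3 H).Local v),
      MeasurableSpace ((cmDatum L 3 H).Local v ⧸ Subgroup.centralizer ({γ} : Set ((cmDatum L 3 H).Local v)))]
    (Δ : ∀ v : HeightOneSpectrum (𝓞 ↥(maximalRealSubfield L)), LocalTransferFactor L H v)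
    (mH : ∀ v : HeightOneSpectrum (𝓞 ↥(maximalRealSubfield L)),
      OrbitalMeasureFamily ((cmDatum L 2 (Matrix.of fun i j : Fin 2 => if i.val + j.val + 1 = 2 then (1 : L) else 0)).Local v ×
        (cmDatum L 1 (Matrix.of fun i j : Fin 1 => if i.val + j.val + 1 = 1 then (1 : L) else 0)).Local v))
    (mG : ∀ v : HeightOneSpectrum (𝓞 ↥(maximalRealSubfield L)), OrbitalMeasureFamily ((cmDatum L 3 H).Local v))
    (νG : ∀ v : HeightOneSpectrum (𝓞 ↥(maximalRealSubfield L)), Measure ((cmDatum L 3 H).Local v))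
    (νH : ∀ v : HeightOneSpectrum (𝓞 ↥(maximalRealSubfield L)),
      Measure ((cmDatum L 2 (Matrix.of fun i j : Fin 2 => if i.val + j.val + 1 = 2 then (1 : L) else 0)).Local v ×
        (cmDatum L 1 (Matrix.of fun i j : Fin 1 => if i.val + j.val + 1 = 1 then (1 : L) else 0)).Local v))
    [∀ v : HeightOneSpectrum (𝓞 ↥(maximalRealSubfield L)), BorelSpace ((cmDatum L 3 H).Local v)]
    [∀ v : HeightOneSpectrum (𝓞 ↥(maximalRealSubfield L)),
      BorelSpace ((cmDatum L 2 (Matrix.of fun i j : Fin 2 => if i.val + j.val + 1 = 2 then (1 : L) else 0)).Local v ×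
        (cmDatum L 1 (Matrix.of fun i j : Fin 1 => if i.val + j.val + 1 = 1 then (1 : L) else 0)).Local v)]
    [∀ (v : HeightOneSpectrum (𝓞 ↥(maximalRealSubfield L)))
        (a : ((cmDatum L 2 (Matrix.of fun i j : Fin 2 => if i.val + j.val + 1 = 2 then (1 : L) else 0)).Local v ×
          (cmDatum L 1 (Matrix.of fun i j : Fin 1 => if i.val + j.val + 1 = 1 then (1 : L) else 0)).Local v)),
      BorelSpace (((cmDatum L 2 (Matrix.of fun i j : Fin 2 => if i.val + j.val + 1 = 2 then (1 : L) else 0)).Local v ×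
          (cmDatum L 1 (Matrix.of fun i j : Fin 1 => if i.val + j.val + 1 = 1 then (1 : L) else 0)).Local v) ⧸
        Subgroup.centralizer ({a} : Set ((cmDatum L 2 (Matrix.of fun i j : Fin 2 => if i.val + j.val + 1 = 2 then (1 : L) else 0)).Local v ×
          (cmDatum L 1 (Matrix.of fun i j : Fin 1 => if i.val + j.val + 1 = 1 then (1 : L) else 0)).Local v)))]
    [∀ (v : HeightOneSpectrum (𝓞 ↥(maximalRealSubfield L))) (γ : (cmDatum L 3 H).Local v),
      BorelSpace ((cmDatum L 3 H).Local v ⧸ Subgroup.centralizer ({γ} : Set ((cmDatum L 3 H).Local v)))]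
    [∀ v, (νG v).IsHaarMeasure] [∀ v, (νG v).IsMulRightInvariant] [∀ v, (νH v).IsHaarMeasure] [∀ v, (νH v).IsMulRightInvariant],
    ∀ (μω : HeckeCharacter L) (hμu : μω.IsUnitary),
    (∀ x : Literature.NumberTheory.GaloisRepresentations.ideleGroup ↥(maximalRealSubfield L),
      μω (AdeleRing.ideleBaseChange (↥(maximalRealSubfield L)) L x) = quadraticHeckeCharCM L x) →
    Δ = finExplicitCollection L H μω (finExplicitDelta_conj_left_all L H μω) (finExplicitDelta_conj_right_all L H μω) →
    (∀ v : HeightOneSpectrum (𝓞 ↥(maximalRealSubfield L)), (mH v).IsCanonical (IsLocalGRegular L v) (νH v) ∧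
      (mG v).IsCanonical (fun γ => IsRegularElt (γ.val : GL (Fin 3) (UnitaryGroup.LocalRing L v))) (νG v)) →
    CMCharIdentityPackageTestSigned L H hH hHd νH νG μω hμu Δ mH mG →
    (∀ v : HeightOneSpectrum (𝓞 ↥(maximalRealSubfield L)), (∀ w : PlacesOver L v, IsCMField.complexConj L • w.1 = w.1) →
      IsLocalDeltaTransferExists L H v (Δ v) (mH v) (mG v) Literature.NumberTheory.Rogawski1990.IsLocSmooth
        Literature.NumberTheory.Rogawski1990.IsLocSmooth) →
    ∀ (ξ : OneDimAutRepH L)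
      (μA : Measure (adelicGroupData (↥(maximalRealSubfield L)) L (IsCMField.complexConj L) 3 H).automorphicQuotient)
      [(adelicGroupData (↥(maximalRealSubfield L)) L (IsCMField.complexConj L) 3 H).IsAutomorphicMeasure μA]
      (P : DiscreteAutomorphicRep (adelicGroupData (↥(maximalRealSubfield L)) L (IsCMField.complexConj L) 3 H) μA),
      MemXiFamily P hH hHd μω hμu ξ →
      ∀ (v : HeightOneSpectrum (𝓞 ↥(maximalRealSubfield L))), (∀ w : PlacesOver L v, IsCMField.complexConj L • w.1 = w.1) →
      ∀ (T : GL (Fin 3) (LocalRing L v)) (a : LocalRing L v) (ha : IsUnit a)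
        (h : formCongr (conjLocal L (IsCMField.complexConj L) v) T (H.map (algebraMap L (LocalRing L v))) =
          a • (Matrix.of fun i j : Fin 3 => if i.val + j.val + 1 = 3 then (1 : L) else 0).map (algebraMap L (LocalRing L v))),
      ∀ [MeasurableSpace (Gqs L v ⧸ Subgroup.center (Gqs L v))] [BorelSpace (Gqs L v ⧸ Subgroup.center (Gqs L v))]
        (μZ : Measure (Gqs L v ⧸ Subgroup.center (Gqs L v))) [μZ.IsHaarMeasure],
      ∀ (π2 πn : IrrClass (Gqs L v)),
        KeysCaseTwoLabels L v (μω.semilocalComponent L v) (torusLocalComponent L (IsCMField.complexConj L) v ξ.η)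
          (torusLocalComponent L (IsCMField.complexConj L) v ξ.ψ) π2 πn →
        ¬ πn.IsSquareIntegrable μZ →
        -- (β) «every SUPERCUSPIDAL v-constituent of P completes πⁿ ∘ e in the SIGNED (13.1.4) on test functions»
        ∀ c : IrrClass ((cmDatum L 3 H).Local v),
          (IrrClass.comap (localPiEquiv L (IsCMField.complexConj L) 3 H v) c).IsConstituentOf
              (P.finRep.smoothPart.toRepresentation.comp (inclPlace (↥(maximalRealSubfield L)) L (IsCMField.complexConj L) 3 H v)) →
          c.IsSupercuspidal →
          (⟨IrrClass.comap (cmDatumLocalCongr L v T ha h).symm πn, some c⟩ : CMLocalAPacket L H v).CharIdentityAtTest L H v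
          (fun c' f => (if ∃ z : LocalRing L v, IsUnit z ∧ a = z * conjLocal L (IsCMField.complexConj L) v z then (1 : ℂ) else -1) *
          c'.smoothTrace (νG v) f)
          (ξ.xiLocalChar v) (νH v) (Δ v) (mH v) (mG v)

/-! ## §2 The organs (sorried here; each payable as a ★ `Theorems/` file `--supports stmt-HodgeConjecture-24833 --as helper`) -/

/- **(O1) — RETIRED UNCONSUMED, NOT paid** [ED. 9 «O1-RETIRE», LEAD T13-21: the sorried TERM `stub_thetaLiftMember` and its only consumer, the road-S closer-side term `Db_T_paid`, are RETIRED — the statement `StubThetaLiftMember`, the head statement `DbTSAtRecord` and the hypothesis-form heads `Db_T_of_organs` ∕ `Db_T_of_organsSc` ∕ `Db_T_of_organs_eq_route` (which take (O1) as a binder) stay verbatim, so road S is re-activatable by any ★ proof of `StubThetaLiftMember`; file sorries become {`stub_xiPacketRigidCoreSc` (O2♮)} only; no consumer in the tree imports this leaf (rg 2026-09-02T11:4xZ), the consumed head under v1.16 «W1 GO» is `Db_T_paidW1`.] — PRINT organ, sorried (road B of record; road A on the automorphic locus). [cite: Rogawski1990, §13.3 Thm. 13.3.7 pp. 202–203;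 §14.6 pp. 242–245] [cite: GelbartRogawski1991, §5.1 Lem. 5.1.2 p. 466; §3.4 Prop. 3.4.1, Thm. 3.4 (a) p. 461] -/
-- theorem stub_thetaLiftMember : StubThetaLiftMember — RETIRED UNCONSUMED, NOT paid (ED. 9 «O1-RETIRE»); see the comment above.

/-- **(O2♮)** — PRINT organ (the supercuspidal clause of 13.3.6 (c) ∕ §14.6 at print's data), sorried (ED. 6 «β»: replaces the sorried (O2♭) of ED. 4∕5-W; clause (α)
dropped from the debt as unconsumed). [cite: Rogawski1990, §13.3 Thm. 13.3.6 (c) p. 202; §14.6 Thm. 14.6.1 p. 241; Thm. 14.6.4 p. 243; pp. 241–245; §13.1 Prop. 13.1.3 (d), Prop. 13.1.4 p. 199; §4.9 p. 55] -/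
theorem stub_xiPacketRigidCoreSc : StubXiPacketRigidCoreSc := by
  sorry

/-- **(O2♮) ⟸ (O2♭)** — the projection onto clause (β): kernel-certifies that ED. 6's organ is WEAKER than ED. 4∕5-W's sorried core (no sorry). -/
theorem stubXiPacketRigidCoreSc_of_core (hcore : StubXiPacketRigidCore) : StubXiPacketRigidCoreSc := by
  intro L _ _ _ H hH hHd _ _ _ _ Δ mH mG νG νH _ _ _ _ _ _ _ _ μω hμu hμω hΔ hcan hQS hex ξ μA _ P hmem v hns T a ha h _ _ μZ _ π2 πn hK hn c hc hsc
  exact (hcore L H hH hHd Δ mH mG νG νH μω hμu hμω hΔ hcan hQS hex ξ μA P hmem v hns T a ha h μZ π2 πn hK hn).2 c hc hsc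

set_option synthInstance.maxHeartbeats 400000 in
set_option maxHeartbeats 4000000 in
/-- **(O2♮) ⟸ (O2)** — from the record dichotomy of ED. 1–3: a supercuspidal constituent is not `πⁿ ∘ e` (★ `F0P3cStCharTSNe.ne_comap_πn_of_isSupercuspidal`), so the
identity branch holds (no sorry).  Kernel-certifies that ED. 6's organ is WEAKER than the (O2) of record too. -/
theorem stubXiPacketRigidCoreSc_of_atRecord (hrec : StubXiPacketRigidAtRecord) : StubXiPacketRigidCoreSc := by
  intro L _ _ _ H hH hHd _ _ _ _ Δ mH mG νG νH _ _ _ _ _ _ _ _ μω hμu hμω hΔ hcan hQS hex ξ μA _ P hmem v hns T a ha h _ _ μZ _ π2 πn hK hn c hc hsc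
  rcases hrec L H hH hHd Δ mH mG νG νH μω hμu hμω hΔ hcan hQS hex ξ μA P hmem v hns T a ha h μZ π2 πn hK hn c hc with heq | hId
  · exact absurd heq (F0P3cStCharTSNe.ne_comap_πn_of_isSupercuspidal L H v hns T a ha h (μω.semilocalComponent L v)
      (torusLocalComponent L (IsCMField.complexConj L) v ξ.η) (torusLocalComponent L (IsCMField.complexConj L) v ξ.ψ) π2 πn hK c hsc)
  · exact hId

/-- **(O2) from (O2♭)**, hypothesis form (ED. 6; in ED. 4∕5-W this was the closed ★ peel applied to the sorried core) — ★
`F0P3cDbTEnvelopePeelPinned.stubXiPacketRigidAtRecord_of_core_pinned` (LH10-p01 p848467) BY NAME. -/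
theorem stubXiPacketRigidAtRecord_of_core (hcore : StubXiPacketRigidCore) : StubXiPacketRigidAtRecord :=
  F0P3cDbTEnvelopePeelPinned.stubXiPacketRigidAtRecord_of_core_pinned hcore

/-! ## §3 The head: (D-b)ᵀˢ BY NAME at record-currency data, PROVED from the two organs + ★ glue -/

/-- **THE (H₈ᵀˢ) SLOT `DbTSAtRecord`: (D-b)ᵀˢ ★ `piSCompletion_isThetaTypeAtCMTestSigned` BY NAME, for every CM frame `(L, H)`, at PRINT'S transfer∕measure data
(`Δ = Δ‴`, canonical orbital measures, Haar `ν_G, ν_H`) carrying the SIGNED character-identity package (every `ξ`) and (H₇), and every rational theta frame and `ξ`, at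
`ξloc := ξ.xiLocalChar`** — the closed-form reading of the consumer's last conjunct with its joint hypotheses made explicit binders (the binding discipline of `hrecT`;
r352 (ii) ∕ r353 (E) ∕ r359 ⑨).
[cite: GelbartRogawski1991, Lem. 5.1.2 p. 466; Thm. 5.1.1 p. 465] [cite: Rogawski1990, §13.1 Prop. 13.1.3 (d), Prop. 13.1.4 p. 199; §4.9 p. 55] -/
def DbTSAtRecord : Prop :=
  ∀ (L : Type) [Field L] [NumberField L] [IsCMField L] (H : Matrix (Fin 3) (Fin 3) L)
    (hH : (H.map (cmConjRingHom L))ᵀ = H) (hHd : IsUnit H.det)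
    [∀ v : HeightOneSpectrum (𝓞 ↥(maximalRealSubfield L)), MeasurableSpace ((cmDatum L 3 H).Local v)]
    [∀ v : HeightOneSpectrum (𝓞 ↥(maximalRealSubfield L)),
      MeasurableSpace ((cmDatum L 2 (Matrix.of fun i j : Fin 2 => if i.val + j.val + 1 = 2 then (1 : L) else 0)).Local v ×
        (cmDatum L 1 (Matrix.of fun i j : Fin 1 => if i.val + j.val + 1 = 1 then (1 : L) else 0)).Local v)]
    [∀ (v : HeightOneSpectrum (𝓞 ↥(maximalRealSubfield L)))
        (a : ((cmDatum L 2 (Matrix.of fun i j : Fin 2 => if i.val + j.val + 1 = 2 then (1 : L) else 0)).Local v ×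
          (cmDatum L 1 (Matrix.of fun i j : Fin 1 => if i.val + j.val + 1 = 1 then (1 : L) else 0)).Local v)),
      MeasurableSpace (((cmDatum L 2 (Matrix.of fun i j : Fin 2 => if i.val + j.val + 1 = 2 then (1 : L) else 0)).Local v ×
          (cmDatum L 1 (Matrix.of fun i j : Fin 1 => if i.val + j.val + 1 = 1 then (1 : L) else 0)).Local v) ⧸
        Subgroup.centralizer ({a} : Set ((cmDatum L 2 (Matrix.of fun i j : Fin 2 => if i.val + j.val + 1 = 2 then (1 : L) else 0)).Local v ×
          (cmDatum L 1 (Matrix.of fun i j : Fin 1 => if i.val + j.val + 1 = 1 then (1 : L) else 0)).Local v)))]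
    [∀ (v : HeightOneSpectrum (𝓞 ↥(maximalRealSubfield L))) (γ : (cmDatum L 3 H).Local v),
      MeasurableSpace ((cmDatum L 3 H).Local v ⧸ Subgroup.centralizer ({γ} : Set ((cmDatum L 3 H).Local v)))]
    (Δ : ∀ v : HeightOneSpectrum (𝓞 ↥(maximalRealSubfield L)), LocalTransferFactor L H v)
    (mH : ∀ v : HeightOneSpectrum (𝓞 ↥(maximalRealSubfield L)),
      OrbitalMeasureFamily ((cmDatum L 2 (Matrix.of fun i j : Fin 2 => if i.val + j.val + 1 = 2 then (1 : L) else 0)).Local v ×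
        (cmDatum L 1 (Matrix.of fun i j : Fin 1 => if i.val + j.val + 1 = 1 then (1 : L) else 0)).Local v))
    (mG : ∀ v : HeightOneSpectrum (𝓞 ↥(maximalRealSubfield L)), OrbitalMeasureFamily ((cmDatum L 3 H).Local v))
    (νG : ∀ v : HeightOneSpectrum (𝓞 ↥(maximalRealSubfield L)), Measure ((cmDatum L 3 H).Local v))
    (νH : ∀ v : HeightOneSpectrum (𝓞 ↥(maximalRealSubfield L)),
      Measure ((cmDatum L 2 (Matrix.of fun i j : Fin 2 => if i.val + j.val + 1 = 2 then (1 : L) else 0)).Local v ×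
        (cmDatum L 1 (Matrix.of fun i j : Fin 1 => if i.val + j.val + 1 = 1 then (1 : L) else 0)).Local v))
    [∀ v : HeightOneSpectrum (𝓞 ↥(maximalRealSubfield L)), BorelSpace ((cmDatum L 3 H).Local v)]
    [∀ v : HeightOneSpectrum (𝓞 ↥(maximalRealSubfield L)),
      BorelSpace ((cmDatum L 2 (Matrix.of fun i j : Fin 2 => if i.val + j.val + 1 = 2 then (1 : L) else 0)).Local v ×
        (cmDatum L 1 (Matrix.of fun i j : Fin 1 => if i.val + j.val + 1 = 1 then (1 : L) else 0)).Local v)]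
    [∀ (v : HeightOneSpectrum (𝓞 ↥(maximalRealSubfield L)))
        (a : ((cmDatum L 2 (Matrix.of fun i j : Fin 2 => if i.val + j.val + 1 = 2 then (1 : L) else 0)).Local v ×
          (cmDatum L 1 (Matrix.of fun i j : Fin 1 => if i.val + j.val + 1 = 1 then (1 : L) else 0)).Local v)),
      BorelSpace (((cmDatum L 2 (Matrix.of fun i j : Fin 2 => if i.val + j.val + 1 = 2 then (1 : L) else 0)).Local v ×
          (cmDatum L 1 (Matrix.of fun i j : Fin 1 => if i.val + j.val + 1 = 1 then (1 : L) else 0)).Local v) ⧸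
        Subgroup.centralizer ({a} : Set ((cmDatum L 2 (Matrix.of fun i j : Fin 2 => if i.val + j.val + 1 = 2 then (1 : L) else 0)).Local v ×
          (cmDatum L 1 (Matrix.of fun i j : Fin 1 => if i.val + j.val + 1 = 1 then (1 : L) else 0)).Local v)))]
    [∀ (v : HeightOneSpectrum (𝓞 ↥(maximalRealSubfield L))) (γ : (cmDatum L 3 H).Local v),
      BorelSpace ((cmDatum L 3 H).Local v ⧸ Subgroup.centralizer ({γ} : Set ((cmDatum L 3 H).Local v)))]
    [∀ v, (νG v).IsHaarMeasure] [∀ v, (νG v).IsMulRightInvariant] [∀ v, (νH v).IsHaarMeasure] [∀ v, (νH v).IsMulRightInvariant],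
    ∀ (μω : HeckeCharacter L) (hμu : μω.IsUnitary),
    (∀ x : Literature.NumberTheory.GaloisRepresentations.ideleGroup ↥(maximalRealSubfield L),
      μω (AdeleRing.ideleBaseChange (↥(maximalRealSubfield L)) L x) = quadraticHeckeCharCM L x) →
    Δ = finExplicitCollection L H μω (finExplicitDelta_conj_left_all L H μω) (finExplicitDelta_conj_right_all L H μω) →
    (∀ v : HeightOneSpectrum (𝓞 ↥(maximalRealSubfield L)), (mH v).IsCanonical (IsLocalGRegular L v) (νH v) ∧
      (mG v).IsCanonical (fun γ => IsRegularElt (γ.val : GL (Fin 3) (UnitaryGroup.LocalRing L v))) (νG v)) →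
    CMCharIdentityPackageTestSigned L H hH hHd νH νG μω hμu Δ mH mG →
    (∀ v : HeightOneSpectrum (𝓞 ↥(maximalRealSubfield L)), (∀ w : PlacesOver L v, IsCMField.complexConj L • w.1 = w.1) →
      IsLocalDeltaTransferExists L H v (Δ v) (mH v) (mG v) Literature.NumberTheory.Rogawski1990.IsLocSmooth
        Literature.NumberTheory.Rogawski1990.IsLocSmooth) →
    ∀ {n' : ℕ} (e₁ : Fin 3 × Fin 1 ≃ Fin n') (dV : Fin 3 → L) (hdV : ∀ i, IsCMField.complexConj L (dV i) = dV i) (hdV0 : ∀ i, dV i ≠ 0)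
      (g : GL (Fin 3) L) (hg : ((g : Matrix (Fin 3) (Fin 3) L).map (cmConjRingHom L))ᵀ * H * (g : Matrix (Fin 3) (Fin 3) L) = Matrix.diagonal dV)
      (ξ : OneDimAutRepH L),
      piSCompletion_isThetaTypeAtCMTestSigned L H Δ mH mG νH νG ξ μω (fun v => ξ.xiLocalChar v) e₁ dV hdV hdV0 g hg 

set_option synthInstance.maxHeartbeats 400000 in
set_option maxHeartbeats 4000000 in
/-- **HEAD `Db_T_of_organs : ‹O1› → ‹O2› → DbTSAtRecord`** — (D-b)ᵀˢ ★ `piSCompletion_isThetaTypeAtCMTestSigned` BY NAME at print's data (ED. 3) — from (O1), (O2) and ★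
`F0P3cStCharTSNe.ne_comap_πn_of_isSupercuspidal`: (O1)'s supercuspidal theta constituent `c₀` of a member is not `πⁿ ∘ e` (★ Ne), so by (O2) it completes `πⁿ ∘ e` in the
signed identity; `⟨ε, c₀⟩` is the witness.  No `Exists.choose`, no completion uniqueness.
[cite: GelbartRogawski1991, Lem. 5.1.2 p. 466; Thm. 5.1.1 p. 465; Thm. 3.4 (a) p. 461] [cite: Rogawski1990, §13.3 Thm. 13.3.6 (c) p. 202; §13.1 Prop. 13.1.3 (d), 13.1.4 p. 199] -/
theorem Db_T_of_organs (O1 : StubThetaLiftMember) (O2 : StubXiPacketRigidAtRecord) : DbTSAtRecord := by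
  intro L _ _ _ H hH hHd _ _ _ _ Δ mH mG νG νH _ _ _ _ _ _ _ _ μω hμu hμω hΔ hcan hQS hex n' e₁ dV hdV hdV0 g hg ξ μ hμ χf
    hχc hχn hD1 hD2 v hns T a ha h _ _ μZ _ π2 πn hK hn
  obtain ⟨ε, μA, hμA, P, hmem, ⟨c₀, hc₀⟩, hall⟩ :=
    O1 L H hH hHd μω hμu hμω e₁ dV hdV hdV0 g hg ξ μ hμ χf hχc hχn hD1 hD2 v hns
  obtain ⟨hsc, hθ⟩ := hall c₀ hc₀
  refine ⟨ε, c₀, ?_, hθ⟩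
  rcases O2 L H hH hHd Δ mH mG νG νH μω hμu hμω hΔ hcan hQS hex ξ μA P hmem v hns T a ha h μZ π2 πn hK hn c₀ hc₀ with heq | hId
  · exact absurd heq (F0P3cStCharTSNe.ne_comap_πn_of_isSupercuspidal L H v hns T a ha h (μω.semilocalComponent L v)
      (torusLocalComponent L (IsCMField.complexConj L) v ξ.η) (torusLocalComponent L (IsCMField.complexConj L) v ξ.ψ) π2 πn hK c₀ hsc)
  · exact hId

set_option synthInstance.maxHeartbeats 400000 in
set_option maxHeartbeats 4000000 in
/-- **HEAD-β `Db_T_of_organsSc : ‹O1› → ‹O2♮› → DbTSAtRecord`** (ED. 6 «β») — the head of record from (O1) and the SUPERCUSPIDAL clause alone: (O1)'s constituent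
`c₀` is supercuspidal of theta type, (O2♮) hands its signed identity with `πⁿ ∘ e` directly; `⟨ε, c₀⟩` is the witness.  Three lines; no trichotomy, no (α), no Ne-glue.
[cite: GelbartRogawski1991, Lem. 5.1.2 p. 466; Thm. 5.1.1 p. 465; Thm. 3.4 (a) p. 461] [cite: Rogawski1990, §13.3 Thm. 13.3.6 (c) p. 202; §14.6 Thm. 14.6.1 p. 241; Thm. 14.6.4 p. 243; pp. 241–245; §13.1 Prop. 13.1.3 (d), 13.1.4 p. 199] -/
theorem Db_T_of_organsSc (O1 : StubThetaLiftMember) (O2 : StubXiPacketRigidCoreSc) : DbTSAtRecord := by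
  intro L _ _ _ H hH hHd _ _ _ _ Δ mH mG νG νH _ _ _ _ _ _ _ _ μω hμu hμω hΔ hcan hQS hex n' e₁ dV hdV hdV0 g hg ξ μ hμ χf
    hχc hχn hD1 hD2 v hns T a ha h _ _ μZ _ π2 πn hK hn
  obtain ⟨ε, μA, hμA, P, hmem, ⟨c₀, hc₀⟩, hall⟩ :=
    O1 L H hH hHd μω hμu hμω e₁ dV hdV hdV0 g hg ξ μ hμ χf hχc hχn hD1 hD2 v hns
  obtain ⟨hsc, hθ⟩ := hall c₀ hc₀
  exact ⟨ε, c₀, O2 L H hH hHd Δ mH mG νG νH μω hμu hμω hΔ hcan hQS hex ξ μA P hmem v hns T a ha h μZ π2 πn hK hn c₀ hc₀ hsc, hθ⟩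

/-- **The head of record from the (O2) of record, for the file's history** (ED. 6: (O2) ⟹ (O2♮) ★, then HEAD-β); same statement as ED. 3–5. -/
theorem Db_T_of_organs_eq_route (O1 : StubThetaLiftMember) (O2 : StubXiPacketRigidAtRecord) : DbTSAtRecord :=
  Db_T_of_organsSc O1 (stubXiPacketRigidCoreSc_of_atRecord O2)

/- [ED. 9 «O1-RETIRE»: term RETIRED together with `stub_thetaLiftMember` (O1 retired unconsumed, not paid); statement `DbTSAtRecord` and the hypothesis-form heads kept; re-activation = one ★ proof of `StubThetaLiftMember` + re-declaring this one line.] **The closer-side reading, «paid modulo the organs»** (ED. 6 «β»): (D-b)ᵀˢ at record-currency data from the two sorried organs (`--axioms` = TRIO + `sorryAx` through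
EXACTLY `stub_thetaLiftMember`, `stub_xiPacketRigidCoreSc`).  Statement bytes of `DbTSAtRecord` unchanged since ED. 3. [cite: GelbartRogawski1991, Lem. 5.1.2 p. 466] -/
-- theorem Db_T_paid : DbTSAtRecord := Db_T_of_organsSc stub_thetaLiftMember stub_xiPacketRigidCoreSc   — RETIRED (ED. 9 «O1-RETIRE»).

/-! ## §4 ROAD W — the weight-one ∕ automorphic locus: (O1-W1) CLOSED BY NAME (★ `F0P3cDbTThetaOccurrenceLiuLocus`, LH10-p02), head `Db_T_paidW1` through {(O2♭)} only

LH10-p02 «AUTOMORPHY GAP» (02:52:49Z ∕ 03:19:42Z): DICT2 pins only the finite idelic check of `χ_f`, and the tree's theta engine [GelbartRogawski1991 §3.4] produces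
the global member `ω(γ, ψ^ε, χ)` exactly for AUTOMORPHIC `χ` and WEIGHT-ONE `μ` (Liu's corner [Liu2021 Prop. 4.13]); off that locus (O1) is print-true by ROAD B only.
F0P2-p06 P2-cone census (03:24:26Z): the `∀ μ χ_f` of DOCKᵀ ∕ (D-b)ᵀˢ is eliminated at ONE site (★ `F0P2oD7alphaMembersThetaClassTest` :143) at the DICT-choice witness
`(grdMu, grdChi)` where `HasWeight L grdMu 1` and `IsAutomorphicOneChar … grdChi` are in scope — so the restricted letter ★∕⊢ `piSCompletion_isThetaTypeAtCMTestSignedW1`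
costs the consumer two arguments.  This section is ADDITIVE: §1–§3 (road S, print-faithful, sorries {(O1), (O2♭)}) are byte-unchanged; §4 states the W1 organ and head
with the Rogawski frame `(ι, T, hT, hdef, h2)` and an automorphic measure `μA` as extra binders (both in scope at the consumer: `OfRowsT`'s
`intro L _ _ _ ι H T hT hdef h2 μω hμu hμω μ _`) and proves the W1 head from (O1-W1) + (O2) by the SAME six lines.  HONEST CAVEAT: a books row paid through `Db_T_paidW1`
is «(D-b)ᵀˢ-W1» (Liu's corner), not print's (D-b) for all DICT-tied `(μ, χ_f)`. -/

/-- **(O1-W1) «Π(ξ)-MEMBER WITH PRESCRIBED SUPERCUSPIDAL CM-THETA CLASS — ON THE LIU LOCUS»**: (O1)'s text with the Rogawski frame `(ι T hT hdef h2)` after `L`,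
`HasWeight L μ 1 → IsAutomorphicOneChar … χf →` after the unit-norm hypothesis, and `∀ (μA) [IsAutomorphicMeasure μA]` before `∀ v`; conclusion = (O1)'s ∃-block
VERBATIM.  = ★ `F0P3cDbTThetaOccurrenceLiuLocus.stubThetaLiftMember_liuLocus` (LH10-p02 p848642, commit da5c4edfd102) ∀-closed in hypothesis form (`χ := ⟨χf, haut⟩`, `hχ := rfl`): road A
[GelbartRogawski1991 §3.4 Prop. 3.4.1, Thm. 3.4 (a)] ∘ Θ-OCC-GEN ∘ S2♯-θ ∘ (SCᴸ)(WAᴸ-2)(NNᴸ)(TCᴸ) ∘ semilocal rigidity (LH1-p04 p848293).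
[cite: GelbartRogawski1991, §3.4 Prop. 3.4.1 pp. 459–460, Thm. 3.4 (a) p. 461; §5.1 Lem. 5.1.2 p. 466] [cite: Rogawski1990, §13.1 Prop. 13.1.3 (d) p. 199] [cite: Liu2021, Def. 4.11 (l. 2090)] -/
def StubThetaLiftMemberW1 : Prop :=
  ∀ (L : Type) [Field L] [NumberField L] [IsCMField L] (ι : L →+* ℂ) (H : Matrix (Fin 3) (Fin 3) L) (T : GL (Fin 3) ℂ)
    (hT : (T : Matrix (Fin 3) (Fin 3) ℂ)ᴴ * H.map ι * (T : Matrix (Fin 3) (Fin 3) ℂ) = Literature.Geometry.ComplexHyperbolic.BallModel.J)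
    (hdef : ∀ τ' : L →+* ℂ, InfinitePlace.mk τ' ≠ InfinitePlace.mk ι → (H.map τ').PosDef) (h2 : 2 ≤ Module.finrank ℚ ↥(maximalRealSubfield L))
    (hH : (H.map (cmConjRingHom L))ᵀ = H) (hHd : IsUnit H.det) (μω : HeckeCharacter L) (hμu : μω.IsUnitary),
    (∀ x : Literature.NumberTheory.GaloisRepresentations.ideleGroup ↥(maximalRealSubfield L),
      μω (AdeleRing.ideleBaseChange (↥(maximalRealSubfield L)) L x) = quadraticHeckeCharCM L x) →
    ∀ {n' : ℕ} (e₁ : Fin 3 × Fin 1 ≃ Fin n') (dV : Fin 3 → L) (hdV : ∀ i, IsCMField.complexConj L (dV i) = dV i) (hdV0 : ∀ i, dV i ≠ 0)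
      (g : GL (Fin 3) L) (hg : ((g : Matrix (Fin 3) (Fin 3) L).map (cmConjRingHom L))ᵀ * H * (g : Matrix (Fin 3) (Fin 3) L) = Matrix.diagonal dV)
      (ξ : OneDimAutRepH L)
      (μ : Literature.NumberTheory.Automorphic.IdeleClassGroup L →ₜ* Circle) (hμ : IsConjugateSymplectic L μ)
      (χf : UnitaryGroup.finAdelicOne (↥(maximalRealSubfield L)) L (IsCMField.complexConj L) →* ℂˣ),
      Continuous χf → (∀ z, ‖((χf z : ℂˣ) : ℂ)‖ = 1) →
      HasWeight L μ 1 → IsAutomorphicOneChar (↥(maximalRealSubfield L)) L (IsCMField.complexConj L) χf →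
      (∀ v : HeightOneSpectrum (𝓞 ↥(maximalRealSubfield L)),
          (toHeckeCharacter L μ).semilocalComponent L v = (ξ.bcη⁻¹ * ξ.bcψ⁻¹ * μω).semilocalComponent L v) →
      (∀ z : (FiniteAdeleRing (𝓞 L) L)ˣ,
          χf (finAdelicCheck (↥(maximalRealSubfield L)) L (IsCMField.complexConj L)
              (AlgEquiv.ext fun x => by rw [AlgEquiv.mul_apply, IsCMField.complexConj_apply_apply, AlgEquiv.one_apply]) z) =
            (ξ.bcψ⁻¹ * (ξ.bcη⁻¹ * ξ.bcψ⁻¹ * μω) ^ 2)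
              (Units.map (N := AdeleRing (𝓞 L) L) (MonoidHom.inr (InfiniteAdeleRing L) (FiniteAdeleRing (𝓞 L) L)) z)) →
      ∀ (μA : Measure (adelicGroupData (↥(maximalRealSubfield L)) L (IsCMField.complexConj L) 3 H).automorphicQuotient)
        [(adelicGroupData (↥(maximalRealSubfield L)) L (IsCMField.complexConj L) 3 H).IsAutomorphicMeasure μA],
      ∀ (v : HeightOneSpectrum (𝓞 ↥(maximalRealSubfield L))), (∀ w : PlacesOver L v, IsCMField.complexConj L • w.1 = w.1) →
        ∃ (ε : (↥(maximalRealSubfield L))ˣ)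
          (μA : Measure (adelicGroupData (↥(maximalRealSubfield L)) L (IsCMField.complexConj L) 3 H).automorphicQuotient)
          (_ : (adelicGroupData (↥(maximalRealSubfield L)) L (IsCMField.complexConj L) 3 H).IsAutomorphicMeasure μA)
          (P : DiscreteAutomorphicRep (adelicGroupData (↥(maximalRealSubfield L)) L (IsCMField.complexConj L) 3 H) μA),
          MemXiFamily P hH hHd μω hμu ξ ∧
          (∃ c : IrrClass ((cmDatum L 3 H).Local v),
            (IrrClass.comap (localPiEquiv L (IsCMField.complexConj L) 3 H v) c).IsConstituentOf
              (P.finRep.smoothPart.toRepresentation.comp (inclPlace (↥(maximalRealSubfield L)) L (IsCMField.complexConj L) 3 H v))) ∧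
          ∀ c : IrrClass ((cmDatum L 3 H).Local v),
            (IrrClass.comap (localPiEquiv L (IsCMField.complexConj L) 3 H v) c).IsConstituentOf
                (P.finRep.smoothPart.toRepresentation.comp (inclPlace (↥(maximalRealSubfield L)) L (IsCMField.complexConj L) 3 H v)) →
              c.IsSupercuspidal ∧ ThetaTypeAtCM L H e₁ dV hdV hdV0 g hg μ hμ χf ε v c

/-- **(O1-W1) — CLOSED BY NAME, no `sorry`**: ★ `F0P3cDbTThetaOccurrenceLiuLocus.stubThetaLiftMember_liuLocus` (LH10-p02 p848642, commit da5c4edfd102) at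
`χ := ⟨χf, haut⟩`, `hχ := rfl` (road A [GelbartRogawski1991 §3.4] ∘ Θ-OCC-GEN ∘ S2♯-θ ∘ (SCᴸ)(WAᴸ-2)(NNᴸ)(TCᴸ) ∘ semilocal rigidity — all ★, in-house end to end).
[cite: GelbartRogawski1991, §3.4 Thm. 3.4 (a) p. 461; Prop. 3.4.1 pp. 459–460] [cite: Liu2021, Def. 4.11 (l. 2090)] -/
theorem stub_thetaLiftMemberW1 : StubThetaLiftMemberW1 :=
  fun L _ _ _ ι H T hT hdef h2 hH hHd μω hμu hμω _ e₁ dV hdV hdV0 g hg ξ μ hμ χf _ _ hw haut hD1 hD2 μA _ v hv =>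
    F0P3cDbTThetaOccurrenceLiuLocus.stubThetaLiftMember_liuLocus L ι H T hT hdef h2 hH hHd μω hμu hμω e₁ dV hdV hdV0 g hg ξ μ hμ χf hD1 hD2 μA
      hw ⟨χf, haut⟩ rfl v hv

/-- **THE (H₈ᵀˢ-W1) SLOT `DbTSAtRecordW1`**: `DbTSAtRecord` (§3) with the Rogawski frame `(ι : L →+* ℂ) (T hT hdef h2)` and an automorphic measure `μA` on
`U(H)(L⁺)\U(H)(𝔸)` as extra binders, concluding ★∕⊢ `piSCompletion_isThetaTypeAtCMTestSignedW1` BY NAME at print's data (`Δ = Δ‴`, canonical orbital measures, Haar,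
the SIGNED package, (H₇)) and `ξloc := ξ.xiLocalChar`.
[cite: GelbartRogawski1991, Lem. 5.1.2 p. 466; Thm. 5.1.1 p. 465] [cite: Rogawski1990, §13.1 Prop. 13.1.3 (d), Prop. 13.1.4 p. 199; §4.9 p. 55] [cite: Liu2021, Def. 4.11 (l. 2090)] -/
def DbTSAtRecordW1 : Prop :=
  ∀ (L : Type) [Field L] [NumberField L] [IsCMField L] (ι : L →+* ℂ) (H : Matrix (Fin 3) (Fin 3) L) (T : GL (Fin 3) ℂ)
    (hT : (T : Matrix (Fin 3) (Fin 3) ℂ)ᴴ * H.map ι * (T : Matrix (Fin 3) (Fin 3) ℂ) = Literature.Geometry.ComplexHyperbolic.BallModel.J)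
    (hdef : ∀ τ' : L →+* ℂ, InfinitePlace.mk τ' ≠ InfinitePlace.mk ι → (H.map τ').PosDef) (h2 : 2 ≤ Module.finrank ℚ ↥(maximalRealSubfield L))
    (hH : (H.map (cmConjRingHom L))ᵀ = H) (hHd : IsUnit H.det)
    [∀ v : HeightOneSpectrum (𝓞 ↥(maximalRealSubfield L)), MeasurableSpace ((cmDatum L 3 H).Local v)]
    [∀ v : HeightOneSpectrum (𝓞 ↥(maximalRealSubfield L)),
      MeasurableSpace ((cmDatum L 2 (Matrix.of fun i j : Fin 2 => if i.val + j.val + 1 = 2 then (1 : L) else 0)).Local v ×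
        (cmDatum L 1 (Matrix.of fun i j : Fin 1 => if i.val + j.val + 1 = 1 then (1 : L) else 0)).Local v)]
    [∀ (v : HeightOneSpectrum (𝓞 ↥(maximalRealSubfield L)))
        (a : ((cmDatum L 2 (Matrix.of fun i j : Fin 2 => if i.val + j.val + 1 = 2 then (1 : L) else 0)).Local v ×
          (cmDatum L 1 (Matrix.of fun i j : Fin 1 => if i.val + j.val + 1 = 1 then (1 : L) else 0)).Local v)),
      MeasurableSpace (((cmDatum L 2 (Matrix.of fun i j : Fin 2 => if i.val + j.val + 1 = 2 then (1 : L) else 0)).Local v ×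
          (cmDatum L 1 (Matrix.of fun i j : Fin 1 => if i.val + j.val + 1 = 1 then (1 : L) else 0)).Local v) ⧸
        Subgroup.centralizer ({a} : Set ((cmDatum L 2 (Matrix.of fun i j : Fin 2 => if i.val + j.val + 1 = 2 then (1 : L) else 0)).Local v ×
          (cmDatum L 1 (Matrix.of fun i j : Fin 1 => if i.val + j.val + 1 = 1 then (1 : L) else 0)).Local v)))]
    [∀ (v : HeightOneSpectrum (𝓞 ↥(maximalRealSubfield L))) (γ : (cmDatum L 3 H).Local v),
      MeasurableSpace ((cmDatum L 3 H).Local v ⧸ Subgroup.centralizer ({γ} : Set ((cmDatum L 3 H).Local v)))]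
    (Δ : ∀ v : HeightOneSpectrum (𝓞 ↥(maximalRealSubfield L)), LocalTransferFactor L H v)
    (mH : ∀ v : HeightOneSpectrum (𝓞 ↥(maximalRealSubfield L)),
      OrbitalMeasureFamily ((cmDatum L 2 (Matrix.of fun i j : Fin 2 => if i.val + j.val + 1 = 2 then (1 : L) else 0)).Local v ×
        (cmDatum L 1 (Matrix.of fun i j : Fin 1 => if i.val + j.val + 1 = 1 then (1 : L) else 0)).Local v))
    (mG : ∀ v : HeightOneSpectrum (𝓞 ↥(maximalRealSubfield L)), OrbitalMeasureFamily ((cmDatum L 3 H).Local v))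
    (νG : ∀ v : HeightOneSpectrum (𝓞 ↥(maximalRealSubfield L)), Measure ((cmDatum L 3 H).Local v))
    (νH : ∀ v : HeightOneSpectrum (𝓞 ↥(maximalRealSubfield L)),
      Measure ((cmDatum L 2 (Matrix.of fun i j : Fin 2 => if i.val + j.val + 1 = 2 then (1 : L) else 0)).Local v ×
        (cmDatum L 1 (Matrix.of fun i j : Fin 1 => if i.val + j.val + 1 = 1 then (1 : L) else 0)).Local v))
    [∀ v : HeightOneSpectrum (𝓞 ↥(maximalRealSubfield L)), BorelSpace ((cmDatum L 3 H).Local v)]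
    [∀ v : HeightOneSpectrum (𝓞 ↥(maximalRealSubfield L)),
      BorelSpace ((cmDatum L 2 (Matrix.of fun i j : Fin 2 => if i.val + j.val + 1 = 2 then (1 : L) else 0)).Local v ×
        (cmDatum L 1 (Matrix.of fun i j : Fin 1 => if i.val + j.val + 1 = 1 then (1 : L) else 0)).Local v)]
    [∀ (v : HeightOneSpectrum (𝓞 ↥(maximalRealSubfield L)))
        (a : ((cmDatum L 2 (Matrix.of fun i j : Fin 2 => if i.val + j.val + 1 = 2 then (1 : L) else 0)).Local v ×
          (cmDatum L 1 (Matrix.of fun i j : Fin 1 => if i.val + j.val + 1 = 1 then (1 : L) else 0)).Local v)),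
      BorelSpace (((cmDatum L 2 (Matrix.of fun i j : Fin 2 => if i.val + j.val + 1 = 2 then (1 : L) else 0)).Local v ×
          (cmDatum L 1 (Matrix.of fun i j : Fin 1 => if i.val + j.val + 1 = 1 then (1 : L) else 0)).Local v) ⧸
        Subgroup.centralizer ({a} : Set ((cmDatum L 2 (Matrix.of fun i j : Fin 2 => if i.val + j.val + 1 = 2 then (1 : L) else 0)).Local v ×
          (cmDatum L 1 (Matrix.of fun i j : Fin 1 => if i.val + j.val + 1 = 1 then (1 : L) else 0)).Local v)))]
    [∀ (v : HeightOneSpectrum (𝓞 ↥(maximalRealSubfield L))) (γ : (cmDatum L 3 H).Local v),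
      BorelSpace ((cmDatum L 3 H).Local v ⧸ Subgroup.centralizer ({γ} : Set ((cmDatum L 3 H).Local v)))]
    [∀ v, (νG v).IsHaarMeasure] [∀ v, (νG v).IsMulRightInvariant] [∀ v, (νH v).IsHaarMeasure] [∀ v, (νH v).IsMulRightInvariant],
    ∀ (μω : HeckeCharacter L) (hμu : μω.IsUnitary),
    (∀ x : Literature.NumberTheory.GaloisRepresentations.ideleGroup ↥(maximalRealSubfield L),
      μω (AdeleRing.ideleBaseChange (↥(maximalRealSubfield L)) L x) = quadraticHeckeCharCM L x) →
    ∀ (μA : Measure (adelicGroupData (↥(maximalRealSubfield L)) L (IsCMField.complexConj L) 3 H).automorphicQuotient)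
      [(adelicGroupData (↥(maximalRealSubfield L)) L (IsCMField.complexConj L) 3 H).IsAutomorphicMeasure μA],
    Δ = finExplicitCollection L H μω (finExplicitDelta_conj_left_all L H μω) (finExplicitDelta_conj_right_all L H μω) →
    (∀ v : HeightOneSpectrum (𝓞 ↥(maximalRealSubfield L)), (mH v).IsCanonical (IsLocalGRegular L v) (νH v) ∧
      (mG v).IsCanonical (fun γ => IsRegularElt (γ.val : GL (Fin 3) (UnitaryGroup.LocalRing L v))) (νG v)) →
    CMCharIdentityPackageTestSigned L H hH hHd νH νG μω hμu Δ mH mG →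
    (∀ v : HeightOneSpectrum (𝓞 ↥(maximalRealSubfield L)), (∀ w : PlacesOver L v, IsCMField.complexConj L • w.1 = w.1) →
      IsLocalDeltaTransferExists L H v (Δ v) (mH v) (mG v) Literature.NumberTheory.Rogawski1990.IsLocSmooth
        Literature.NumberTheory.Rogawski1990.IsLocSmooth) →
    ∀ {n' : ℕ} (e₁ : Fin 3 × Fin 1 ≃ Fin n') (dV : Fin 3 → L) (hdV : ∀ i, IsCMField.complexConj L (dV i) = dV i) (hdV0 : ∀ i, dV i ≠ 0)
      (g : GL (Fin 3) L) (hg : ((g : Matrix (Fin 3) (Fin 3) L).map (cmConjRingHom L))ᵀ * H * (g : Matrix (Fin 3) (Fin 3) L) = Matrix.diagonal dV)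
      (ξ : OneDimAutRepH L),
      piSCompletion_isThetaTypeAtCMTestSignedW1 L H Δ mH mG νH νG ξ μω (fun v => ξ.xiLocalChar v) e₁ dV hdV hdV0 g hg

set_option maxHeartbeats 1000000 in
/-- **MONOTONICITY — THE W1 HEAD IS WEAKER THAN THE HEAD OF RECORD**: `DbTSAtRecord → DbTSAtRecordW1`, by ★
`piSCompletion_isThetaTypeAtCMTestSigned_toW1` (p848883) BY NAME — the Rogawski frame `(ι T hT hdef h2)` and the automorphic measure `μA` of the W1 head are
simply not used (F0P2-ref1 r364 (2)(ii) token rule carried to the head twin; heir desk F0P3-plan (g14) DEALER BOARD #1 (1)(b)).  Kernel-certifies that §4 does not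
strengthen §3.  [cite: GelbartRogawski1991, Lem. 5.1.2 p. 466] [cite: Liu2021, Def. 4.11 (l. 2090)] -/
theorem dbTSAtRecord_toW1 : DbTSAtRecord → DbTSAtRecordW1 := by
  intro h L _ _ _ ι H T hT hdef h2 hH hHd _ _ _ _ Δ mH mG νG νH _ _ _ _ _ _ _ _ μω hμu hμω μA _ hΔ hcan hQS hex n' e₁ dV hdV hdV0 g hg ξ
  exact piSCompletion_isThetaTypeAtCMTestSigned_toW1 L H Δ mH mG νH νG ξ μω (fun v => ξ.xiLocalChar v) e₁ dV hdV hdV0 g hg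
    (h L H hH hHd Δ mH mG νG νH μω hμu hμω hΔ hcan hQS hex e₁ dV hdV hdV0 g hg ξ)

set_option synthInstance.maxHeartbeats 400000 in
set_option maxHeartbeats 4000000 in
/-- **HEAD-W1 `Db_T_of_organsW1 : ‹O1-W1› → ‹O2› → DbTSAtRecordW1`** — the §3 proof verbatim with the frame, `hw`, `haut` and `μA` threaded into (O1-W1); (O2) is
applied at the member's own measure.  No `Exists.choose`, no completion uniqueness.
[cite: GelbartRogawski1991, Lem. 5.1.2 p. 466; Thm. 3.4 (a) p. 461] [cite: Rogawski1990, §13.3 Thm. 13.3.6 (c) p. 202; §13.1 Prop. 13.1.3 (d), 13.1.4 p. 199] -/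
theorem Db_T_of_organsW1 (O1 : StubThetaLiftMemberW1) (O2 : StubXiPacketRigidAtRecord) : DbTSAtRecordW1 := by
  intro L _ _ _ ι H T hT hdef h2 hH hHd _ _ _ _ Δ mH mG νG νH _ _ _ _ _ _ _ _ μω hμu hμω μA _ hΔ hcan hQS hex n' e₁ dV hdV hdV0 g hg ξ
    μ hμ χf hχc hχn hw haut hD1 hD2 v hns Tv a ha h _ _ μZ _ π2 πn hK hn
  obtain ⟨ε, μA', hμA', P, hmem, ⟨c₀, hc₀⟩, hall⟩ :=
    O1 L ι H T hT hdef h2 hH hHd μω hμu hμω e₁ dV hdV hdV0 g hg ξ μ hμ χf hχc hχn hw haut hD1 hD2 μA v hns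
  obtain ⟨hsc, hθ⟩ := hall c₀ hc₀
  refine ⟨ε, c₀, ?_, hθ⟩
  rcases O2 L H hH hHd Δ mH mG νG νH μω hμu hμω hΔ hcan hQS hex ξ μA' P hmem v hns Tv a ha h μZ π2 πn hK hn c₀ hc₀ with heq | hId
  · exact absurd heq (F0P3cStCharTSNe.ne_comap_πn_of_isSupercuspidal L H v hns Tv a ha h (μω.semilocalComponent L v)
      (torusLocalComponent L (IsCMField.complexConj L) v ξ.η) (torusLocalComponent L (IsCMField.complexConj L) v ξ.ψ) π2 πn hK c₀ hsc)
  · exact hId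

set_option synthInstance.maxHeartbeats 400000 in
set_option maxHeartbeats 4000000 in
/-- **HEAD-W1-β `Db_T_of_organsW1Sc : ‹O1-W1› → ‹O2♮› → DbTSAtRecordW1`** (ED. 6 «β») — the W1 head from the ★-closed (O1-W1) and the SUPERCUSPIDAL clause alone,
(O2♮) applied at the member's own measure; three lines, no (α), no Ne-glue.  With (O1-W1) ★ this puts the whole W1 road through ONE print clause.
[cite: GelbartRogawski1991, Lem. 5.1.2 p. 466; Thm. 3.4 (a) p. 461] [cite: Rogawski1990, §13.3 Thm. 13.3.6 (c) p. 202; §14.6 Thm. 14.6.1 p. 241; Thm. 14.6.4 p. 243; pp. 241–245; §13.1 Prop. 13.1.3 (d), 13.1.4 p. 199] [cite: Liu2021, Def. 4.11 (l. 2090)] -/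
theorem Db_T_of_organsW1Sc (O1 : StubThetaLiftMemberW1) (O2 : StubXiPacketRigidCoreSc) : DbTSAtRecordW1 := by
  intro L _ _ _ ι H T hT hdef h2 hH hHd _ _ _ _ Δ mH mG νG νH _ _ _ _ _ _ _ _ μω hμu hμω μA _ hΔ hcan hQS hex n' e₁ dV hdV hdV0 g hg ξ
    μ hμ χf hχc hχn hw haut hD1 hD2 v hns Tv a ha h _ _ μZ _ π2 πn hK hn
  obtain ⟨ε, μA', hμA', P, hmem, ⟨c₀, hc₀⟩, hall⟩ :=
    O1 L ι H T hT hdef h2 hH hHd μω hμu hμω e₁ dV hdV hdV0 g hg ξ μ hμ χf hχc hχn hw haut hD1 hD2 μA v hns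
  obtain ⟨hsc, hθ⟩ := hall c₀ hc₀
  exact ⟨ε, c₀, O2 L H hH hHd Δ mH mG νG νH μω hμu hμω hΔ hcan hQS hex ξ μA' P hmem v hns Tv a ha h μZ π2 πn hK hn c₀ hc₀ hsc, hθ⟩

/-- **«Paid modulo (O2♮) on the Liu locus»** (ED. 6 «β»): (D-b)ᵀˢ-W1 at record-currency data (`--axioms` = TRIO + `sorryAx` through EXACTLY `stub_xiPacketRigidCoreSc`;
(O1-W1) is ★).  Statement bytes of `DbTSAtRecordW1` unchanged since ED. 5-W. [cite: GelbartRogawski1991, Lem. 5.1.2 p. 466] [cite: Liu2021, Def. 4.11 (l. 2090)] -/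
theorem Db_T_paidW1 : DbTSAtRecordW1 :=
  Db_T_of_organsW1Sc stub_thetaLiftMemberW1 stub_xiPacketRigidCoreSc

/-! ## §5 ROAD Θ — the LOCAL typing of the W1 residual (★ `Theorems/F0P3cDbTThetaRoadW1`, p850793; LH10-plan (g3), LH10-p01 (g4); ED. 8)

(O2θ-W1) `F0P3cDbTThetaRoadW1.StubThetaTypeScCompletesW1` = (O2♮)'s pinned-data binder block VERBATIM through (H₇), then the W1 head's own local block
(`e₁ dV hdV hdV0 g hg ξ μ hμ χf`, continuity, unit norm, `HasWeight L μ 1`, `IsAutomorphicOneChar … χf`, the two DICT ties, the non-split `v`, the form congruence, `μZ`,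
the Keys labels, `¬ πⁿ` square-integrable) and the conclusion «`∀ ε c, ThetaTypeAtCM … μ hμ χf ε v c → c.IsSupercuspidal → ⟨πⁿ ∘ e, some c⟩.CharIdentityAtTest …`» (signed,
at `ξ.xiLocalChar v`).  NEITHER (O2♮) ⇒ (O2θ-W1) NOR conversely by logic (global-∀P vs local-∀θ-type); both are print-true; neither is payable in-house this programme
(O2♮: inner-form comparison; O2θ-W1: the local character of the supercuspidal Weil piece — banked programme P7).  HONEST LABEL: a books row paid through
`Db_T_of_thetaRoadW1 h` for a sorried `h` would be «(D-b)ᵀˢ-W1 modulo [GR91 Lem. 5.1.2 πˢ-half + R90 13.1.3 (d)]»; through `Db_T_paidW1` it is «… modulo [R90 13.3.6 (c) + §14.6]».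
Nothing here pays a printed citation. -/

set_option maxHeartbeats 4000000 in
/-- **HEAD-W1-Θ `Db_T_of_thetaRoadW1 : ‹O2θ-W1› → DbTSAtRecordW1`** (ED. 8; hypothesis form, no `sorry`): ★ `F0P3cDbTThetaRoadW1.dbTSAtRecordW1_of_thetaRoad` (p850793) BY NAME —
its statement is the body of `DbTSAtRecordW1` verbatim, so the term is accepted by δ-unfolding (scratch-certified before filing: LH10-plan (g3)
`scratch.thetaRoad.leafConsumes.lean`, farm rc 0).  The proof inside the letter is HEAD-W1-β's with ★ (O1-W1) inlined and (O2θ-W1) applied at (O1-W1)'s supercuspidal theta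
constituent `c₀`.  [cite: GelbartRogawski1991, §5.1 (5.1.1), Lem. 5.1.2 p. 466; Thm. 3.4 (a) p. 461] [cite: Rogawski1990, §13.1 Prop. 13.1.3 (d), Prop. 13.1.4 p. 199; §4.9 p. 55] [cite: Liu2021, Def. 4.11 (l. 2090)] -/
theorem Db_T_of_thetaRoadW1 (O2θ : F0P3cDbTThetaRoadW1.StubThetaTypeScCompletesW1) : DbTSAtRecordW1 :=
  F0P3cDbTThetaRoadW1.dbTSAtRecordW1_of_thetaRoad O2θ

end Summit.HodgeConjecture.HodgeConjecture.Cruxes.H413.F0P3cDbTPaydown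

end
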